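import Literature.MathematicalPhysics.QuantumManyBody.LiebSimpleEquationPinned
import Literature.MathematicalPhysics.QuantumManyBody.YukawaSubordination
import Mathlib.Analysis.Fourier.Convolution
import Mathlib.Analysis.SpecialFunctions.JapaneseBracket
import HarnessLib

/-!
# Lieb's simple equation: the `|x|⁻⁴` tail constant of CJL-II Theorem 2 (the printed `β` is off by 3)

Topic: `Literature/MathematicalPhysics/QuantumManyBody`. Erratum evidence (everything proved) for
CJL-II Theorem 2 AS PRINTED (CJL-II = Carlen–Jauslin–Lieb, SIAM J. Math. Anal. 53 (2021),
arXiv:2010.13882; Theorem 2 of the arXiv version, "Large `|x|` asymptotics of `u`":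
`ρu(x) = √(2+β)/(2π²√e)|x|⁻⁴ + R(x)`, `β = ρ∫|x|²v(1 − u)dx`, `|x|⁴R ∈ L² ∩ L^∞`), found while
reviewing for discharge its verbatim transcription, the then named fact `CarlenJauslinLieb2021_thm2`
of `LiebSimpleEquationFacts.lean` — since retired from the fact list (D-0014: a refuted `Prop` is
not offered as a hypothesis); the printed statement is kept verbatim in the type of
`not_CarlenJauslinLieb2021_thm2_of_thm1` below. Numbering below is that of the arXiv version;
CJL-I = Pure Appl. Anal. 2 (2020), arXiv:1912.04987.

## The defect in print

The proof of CJL-II Theorem 2 (§2) works with `κ = |k|/(2√e)`, the Fourier-transformed equation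
`ρû = (κ² + 1)(1 − √(1 − (ρ/2e)Ŝ/(κ² + 1)²))`, `Ŝ(k) = ∫e^{ikx}(1 − u)v` (§1, display (uhat)),
and the expansion "`(ρ/2e)Ŝ = 1 − βκ² + O(κ⁴)`" with "`β = −(ρ/4e)∂²_κŜ ≤ ρ‖x²v‖₁`" (§2, third and
fourth displays); this `β` is the one that reaches the constant `√(2+β)/(2π²√e)` (through
`Û₁`, (U1)–(f1x)). For the radial function `S = (1 − u)v` on `ℝ³`,
`Ŝ(k) = Ŝ(0) − (|k|²/6)∫|x|²S + O(|k|⁴)` (`∫(ê·x)²S = ⅓∫|x|²S`), so with `|k|² = 4eκ²` the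
proof's `β` equals `(ρ/3)∫|x|²v(1 − u)dx` — ONE THIRD of the closed form
`β = ρ∫|x|²v(1 − u)dx` printed in the statement of the theorem (display (betadef)) and rendered
by the tree's `decayBeta`. With the printed `β` the subtracted tail has the wrong coefficient,
`|x|⁴R(x) → (√(2+β/3) − √(2+β))/(2π²√e) ≠ 0`, and `|x|⁴R ∉ L²(ℝ³)`. (The `L^∞` clause and the
uniform bound `u ≤ C/(ρ√e|x|⁴)` are insensitive to the constant.) The corrected statement is
Theorem 2 with `β := (ρ/3)∫|x|²v(1 − u)dx` (equivalently `ρ∫x₃²v(1 − u)dx`). The facts file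
records the same discrepancy independently (its `correctedDecayCoeff = √(2 + β/3)/(2π²√e)`,
`correctedDecayRemainder`, `integral_inner_sq_mul_eq_of_radial`, the corrected statement as text;
its first refutation was CONDITIONAL on the corrected `L²` clause holding for every solution
triple); the present file needs no such assumption — it computes the tail constant from the
equation itself — and nothing here is a new named fact.

## What is proved here (no Fourier inversion, no Plancherel)

Everything is in Mathlib's convention `𝓕f(ξ) = ∫e^{-2πi⟨x,ξ⟩}f(x)dx` (`k = 2πξ`).

* `fourier_heatKernel_mixture` — Fourier transforms of heat-kernel mixtures
  `Φ = ∫₀^∞ w(s)G_s ds` (`𝓕Φ(ξ) = ∫₀^∞ w(s)e^{-4π²s|ξ|²}ds`; Fubini and the tree's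
  `fourierIntegral_heatKernel_holds`); hence **`fourier_yukawa`**: `𝓕Y_μ = (μ + 4π²|ξ|²)⁻¹`
  (subordination `Y_μ = ∫₀^∞e^{-μs}G_s ds`, the tree's `Coulomb.integral_Ioi_exp_neg_mul_heatKernel`)
  and **`fourier_refTail`**: `𝓕[(1 + |x|²)⁻²] = π²e^{-2π|ξ|}` (weight
  `(π^{3/2}/2)s^{-3/2}e^{-1/(4s)}`, the tree's `Coulomb.lintegral_rpow_neg_three_halves_exp`).
* `IsSolution.comp_neg` (reflection invariance of the simple equation for even potentials),
  `fourier_ofReal_im_eq_zero` (real even functions have real Fourier transforms).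
* **`IsSolution.fourier_eq`** — the simple equation in Fourier space,
  `(4e + 4π²|ξ|²)û = Ŝ + 2eρû²` (mild form `u = Y_{4e} ∗ (S + 2eρu∗u)`, Mathlib's convolution
  theorem `Real.fourier_mul_convolution_eq`, `fourier_yukawa`), and
  **`IsSolution.rho_mul_fourier_re_eq`** — CJL's (uhat) in the form
  `ρû(ξ) = A − √(A² − (ρ/2e)Ŝ)`, `A = 1 + π²|ξ|²/e`, for even solutions; the root is selected by
  `ρû ≤ ρ∫u = 1 ≤ A` (CJL-I (1.6), the tree's `IsSolution.integral_eq`), with no continuity argument.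
* `tendsto_integral_one_sub_cos_div_sq` (second-order expansion of a real Fourier transform along
  a ray, dominated convergence), `integrable_one_add_norm_sq_mul` (`|x|⁴R ∈ L²`, `R` bounded ⟹
  `(1 + |x|²)R ∈ L¹`), `abs_fourier_re_sub_le` (`|Re R̂(tη) − Re R̂(0)| ≤ 2π²t²∫⟨x,η⟩²|R|`).
* **`IsSolution.tail_coefficient_sq_eq`, `IsSolution.tail_coefficient_eq` (main theorem).** For a
  CJL-II potential `v` and an EVEN solution triple `(ρ, e, u)`, `ρ, e > 0`: if
  `|x|⁴(ρu − c'|x|⁻⁴) ∈ L²(ℝ³)` for some real `c'`, then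
  `c' = √(2 + (ρ/3)∫|x|²(1 − u)v)/(2π²√e)`. Proof: for a unit vector `η` put `y(t) = ρû(tη)`.
  From the equation, `(1 − y(t))/|t| → (π/√e)√(2 + ρ∫⟨x,η⟩²S)` (`Ŝ(0) − Ŝ(tη) ∼ 2π²t²∫⟨x,η⟩²S`).
  From the decomposition `ρu = c'T + R'`, `T = (1 + |x|²)⁻²`, one has `y(t) = c'π²e^{-2π|t|} + R̂'(tη)`
  with `R̂'` moving by `O(t²)` (second moments of `R'`), so `(1 − y(t))/|t| → 2π³c'`. Hence
  `∫⟨x,η⟩²S = (4π⁴ec'² − 2)/ρ` for EVERY unit `η`; summing over an orthonormal basis gives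
  `∫|x|²S = 3(4π⁴ec'² − 2)/ρ`, i.e. the claim (only evenness of `u` is used — no rotation
  invariance — because the per-direction identity already makes `∫⟨x,η⟩²S` independent of `η`).
* **`IsSolution.eq_correctedDecayCoeff_of_memLp_two`** — hence any `L²` tail constant of an even
  solution triple is the facts file's `correctedDecayCoeff`; and
  **`IsSolution.not_memLp_decayRemainder`** — with the printed constant (`decayCoeff`) the `L²`
  clause fails for every even solution triple (`decayCoeff ≠ correctedDecayCoeff` as `β > 0`, the
  facts file's `IsSolution.decayCoeff_ne_correctedDecayCoeff`).
* **`not_CarlenJauslinLieb2021_thm2_of_thm1 : CarlenJauslinLieb2020_thm1 → ¬ (CJL-II Theorem 2 as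
  printed)`** — the printed theorem stated verbatim in the type (the tree's rendering: solution
  triples `(ρ, e, u)`, `ρ, e > 0`, CJL-II potentials `v ≢ 0`, `decayBeta`, `decayRemainder`, the
  pointwise bound in division-free form); for `v = 𝟙_{|x| ≤ 1}` CJL-I Theorem 1 gives a solution
  triple `(ρ(1), 1, u)`, even by uniqueness (`even_of_existsUnique`), to which the previous item
  applies. (`LiebSimpleEquationFactsRefuted.lean` feeds in `CarlenJauslinLieb2020_thm1_holds`:
  `not_CarlenJauslinLieb2021_thm2`, unconditional.)

Which side is wrong: CJL-I Theorem 1 (existence and uniqueness) is the robust one and enters only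
to produce one even solution triple; the contradiction is between the printed closed form of `β`
and CJL's own Fourier computation, so it is CJL-II Theorem 2 as printed that is misstated, by the
factor `3` in `β` (history: it was vendored verbatim as the named fact `CarlenJauslinLieb2021_thm2`,
found refuted while attempting its discharge, and retired from the fact list in favour of this
file and `LiebSimpleEquationFactsRefuted.lean`). Independently of print,
`IsSolution.tail_coefficient_eq` shows that ANY `L²`-remainder form of the decay theorem must
carry `β/3`.

## References

* [CarlenJauslinLieb2021] E. A. Carlen, I. Jauslin, E. H. Lieb, *Analysis of a simple equation for
  the ground state of the Bose gas II: monotonicity, convexity, and condensate fraction*, SIAM J.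
  Math. Anal. 53 (2021) 5322–5360, arXiv:2010.13882 (arXiv numbering): Theorem 2 with (betadef);
  §1 display (uhat) (`ρû`, `Ŝ`); §2, proof of Theorem 2: `κ = |k|/(2√e)`, "`(ρ/2e)Ŝ = 1 − βκ² + O(κ⁴)`",
  "`β = −(ρ/4e)∂²_κŜ`", (U1)–(f1x), (U1decay).
* [CarlenJauslinLieb2020] E. A. Carlen, I. Jauslin, E. H. Lieb, *Analysis of a simple equation for
  the ground state energy of the Bose gas*, Pure Appl. Anal. 2 (2020) 659–684, arXiv:1912.04987:
  Theorem 1, (1.6), (1.8)–(1.10).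
* [LiebLoss2001] E. H. Lieb, M. Loss, *Analysis*, 2nd ed., AMS (2001), Thm. 6.23 (Yukawa
  potential), Thm. 5.9 (Fourier transforms of radial power-type kernels), for the classical
  transforms used here.
-/

noncomputable section

open MeasureTheory Filter Set
open scoped ENNReal Topology FourierTransform RealInnerProductSpace
open Literature.Analysis.UnboundedOperators

namespace Literature.MathematicalPhysics.QuantumManyBody

namespace LiebSimpleEquation

open BoseGas (Space)

/-! ## Fourier transforms of heat-kernel mixtures (Gaussian subordination) -/

/-- The Fourier character as a complex exponential inside `𝓕`:
`𝓕 F ξ = ∫ exp(-2πi⟪x,ξ⟫) F(x) dx`. [folklore] -/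
theorem fourier_eq_integral_exp (F : Space → ℂ) (ξ : Space) :
    𝓕 F ξ = ∫ x, Complex.exp (↑(-2 * Real.pi * ⟪x, ξ⟫) * Complex.I) * F x := by
  rw [Real.fourier_eq]
  congr 1
  funext x
  rw [Circle.smul_def, smul_eq_mul, Real.fourierChar_apply]
  congr 2
  push_cast
  ring

/-- `|exp(-2πi⟪x,ξ⟫) F(x)| = |F(x)|`. [folklore] -/
theorem norm_exp_mul (F : Space → ℂ) (ξ x : Space) :
    ‖Complex.exp (↑(-2 * Real.pi * ⟪x, ξ⟫) * Complex.I) * F x‖ = ‖F x‖ := by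
  rw [norm_mul, Complex.norm_exp_ofReal_mul_I, one_mul]

/-- The heat kernel of `ℝ³` is jointly measurable in `(x, s)`. [folklore] -/
theorem measurable_heatKernel_uncurry :
    Measurable fun q : Space × ℝ => heatKernel q.2 q.1 := by
  have : (fun q : Space × ℝ => heatKernel q.2 q.1) =
      fun q => (4 * Real.pi * q.2) ^ (-(3 / 2 : ℝ)) * Real.exp (-‖q.1‖ ^ 2 / (4 * q.2)) :=
    funext fun q => BoseGas.heatKernel_three q.2 q.1
  rw [this]
  exact ((measurable_const.mul measurable_snd).pow_const _).mul (by fun_prop)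

/-- **Fourier transform of a heat-kernel mixture.** If `Φ(x) = ∫₀^∞ w(s) G_s(x) ds` for a.e. `x`,
with a weight `w ≥ 0` integrable on `(0,∞)` (`G_s` the Gauss–Weierstrass kernel of `ℝ³`), then
`𝓕Φ(ξ) = ∫₀^∞ w(s) e^{-4π²s|ξ|²} ds` (Fubini and `𝓕G_s = e^{-4π²s|·|²}`). [folklore] -/
theorem fourier_heatKernel_mixture {w : ℝ → ℝ} (hwm : Measurable w) (hw0 : ∀ s, 0 < s → 0 ≤ w s)
    (hwi : IntegrableOn w (Ioi 0)) {Φ : Space → ℝ}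
    (hΦ : ∀ᵐ x ∂(volume : Measure Space), Φ x = ∫ s in Ioi 0, w s * heatKernel s x) (ξ : Space) :
    𝓕 (fun x => (Φ x : ℂ)) ξ = ((∫ s in Ioi 0, w s * heatSymbol s ξ : ℝ) : ℂ) := by
  set χ : Space → ℂ := fun x => Complex.exp (↑(-2 * Real.pi * ⟪x, ξ⟫) * Complex.I) with hχ
  have hχc : Continuous χ := by
    have : Continuous fun x : Space => ⟪x, ξ⟫ := continuous_inner.comp (continuous_id.prodMk continuous_const)
    fun_prop
  have hχn : ∀ x, ‖χ x‖ = 1 := fun x => Complex.norm_exp_ofReal_mul_I _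
  -- the integrand of the double integral
  set G : Space × ℝ → ℂ := fun q => χ q.1 * ((w q.2 * heatKernel q.2 q.1 : ℝ) : ℂ) with hG
  have hGmeas : Measurable G := by
    have hm1 : Measurable fun q : Space × ℝ => χ q.1 := hχc.measurable.comp measurable_fst
    have hm2 : Measurable fun q : Space × ℝ => ((w q.2 * heatKernel q.2 q.1 : ℝ) : ℂ) :=
      Complex.measurable_ofReal.comp ((hwm.comp measurable_snd).mul measurable_heatKernel_uncurry)
    exact hm1.mul hm2
  have hGm : AEStronglyMeasurable G ((volume : Measure Space).prod (volume.restrict (Ioi 0))) :=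
    hGmeas.aestronglyMeasurable
  have hGn : ∀ q : Space × ℝ, 0 < q.2 → ‖G q‖ = w q.2 * heatKernel q.2 q.1 := by
    intro q hq
    rw [hG]
    simp only
    rw [norm_mul, hχn, one_mul, Complex.norm_real, Real.norm_of_nonneg]
    exact mul_nonneg (hw0 _ hq) (heatKernel_pos hq _).le
  have hGi : Integrable G ((volume : Measure Space).prod (volume.restrict (Ioi 0))) := by
    rw [integrable_prod_iff' hGm]
    constructor
    · rw [ae_restrict_iff' measurableSet_Ioi]
      refine Eventually.of_forall fun s hs => ?_
      have hs0 : 0 < s := hs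
      have h1 : Integrable (fun x : Space => w s * heatKernel s x) :=
        (integrable_heatKernel_holds hs0).const_mul _
      refine (h1.ofReal.bdd_mul (c := 1) (hχc.aestronglyMeasurable)
        (Eventually.of_forall fun x => (hχn x).le)).congr (Eventually.of_forall fun x => ?_)
      simp [hG]
    · have h2 : ∀ s ∈ Ioi (0 : ℝ), ∫ x : Space, ‖G (x, s)‖ = w s := by
        intro s hs
        have hs0 : 0 < s := hs
        have : (fun x : Space => ‖G (x, s)‖) = fun x => w s * heatKernel s x :=
          funext fun x => hGn (x, s) hs0
        rw [this, integral_const_mul, integral_heatKernel_eq_one_holds hs0, mul_one]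
      exact hwi.congr_fun (fun s hs => (h2 s hs).symm) measurableSet_Ioi
  -- Step 1: insert the mixture and pull the character inside
  have step1 : 𝓕 (fun x => (Φ x : ℂ)) ξ = ∫ x, ∫ s in Ioi 0, G (x, s) := by
    rw [fourier_eq_integral_exp]
    refine integral_congr_ae ?_
    filter_upwards [hΦ] with x hx
    rw [hx, ← integral_complex_ofReal, ← integral_const_mul]
  -- Step 2: Fubini
  have step2 : ∫ x, ∫ s in Ioi 0, G (x, s) = ∫ s in Ioi 0, ∫ x, G (x, s) :=
    integral_integral_swap hGi
  -- Step 3: the Fourier transform of the heat kernel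
  have step3 : ∀ s ∈ Ioi (0 : ℝ), ∫ x, G (x, s) = ((w s * heatSymbol s ξ : ℝ) : ℂ) := by
    intro s hs
    have hs0 : 0 < s := hs
    have h := fourierIntegral_heatKernel_holds (E := Space) hs0 ξ
    rw [fourier_eq_integral_exp] at h
    calc ∫ x, G (x, s) = ∫ x, (w s : ℂ) * (χ x * (heatKernel s x : ℂ)) := by
          refine integral_congr_ae (Eventually.of_forall fun x => ?_)
          simp only [hG]
          push_cast
          ring
      _ = (w s : ℂ) * (heatSymbol s ξ : ℂ) := by rw [integral_const_mul, h]
      _ = ((w s * heatSymbol s ξ : ℝ) : ℂ) := by push_cast; ring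
  rw [step1, step2, ← integral_complex_ofReal]
  exact setIntegral_congr_fun measurableSet_Ioi step3

/-- **The Fourier transform of the Yukawa potential**: `𝓕Y_μ(ξ) = (μ + 4π²|ξ|²)⁻¹` for `μ > 0`
(Mathlib's convention `𝓕f(ξ) = ∫e^{-2πi⟨x,ξ⟩}f`), by subordination `Y_μ = ∫₀^∞ e^{-μs}G_s ds`
(the tree's `Coulomb.integral_Ioi_exp_neg_mul_heatKernel`). [folklore] -/
theorem fourier_yukawa {μ : ℝ} (hμ : 0 < μ) (ξ : Space) :
    𝓕 (fun x => (yukawa μ x : ℂ)) ξ = (((μ + (2 * Real.pi) ^ 2 * ‖ξ‖ ^ 2)⁻¹ : ℝ) : ℂ) := by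
  have hae : ∀ᵐ x ∂(volume : Measure Space), yukawa μ x =
      ∫ s in Ioi 0, Real.exp (-(μ * s)) * heatKernel s x := by
    have h0 : ∀ᵐ x ∂(volume : Measure Space), x ≠ 0 := by
      have : (volume : Measure Space) {x | ¬x ≠ 0} = 0 := by
        simp only [ne_eq, not_not, setOf_eq_eq_singleton, measure_singleton]
      exact ae_iff.2 this
    filter_upwards [h0] with x hx
    rw [(Coulomb.integral_Ioi_exp_neg_mul_heatKernel hx hμ).2, yukawa]
  have hwi : IntegrableOn (fun s => Real.exp (-(μ * s))) (Ioi 0) := by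
    have h := exp_neg_integrableOn_Ioi 0 hμ
    exact h.congr_fun (fun s _ => by ring_nf) measurableSet_Ioi
  rw [fourier_heatKernel_mixture (by fun_prop) (fun s _ => (Real.exp_pos _).le) hwi hae ξ]
  congr 1
  -- `∫₀^∞ e^{-μs} e^{-4π²|ξ|²s} ds = (μ + 4π²|ξ|²)⁻¹`
  have hc : 0 < μ + (2 * Real.pi) ^ 2 * ‖ξ‖ ^ 2 := by positivity
  have h1 : ∀ s : ℝ, Real.exp (-(μ * s)) * heatSymbol s ξ =
      Real.exp ((-(μ + (2 * Real.pi) ^ 2 * ‖ξ‖ ^ 2)) * s) := by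
    intro s
    rw [heatSymbol, ← Real.exp_add]
    congr 1
    ring
  simp_rw [h1]
  rw [integral_exp_mul_Ioi (by linarith) 0, mul_zero, Real.exp_zero, neg_div, ← div_neg, neg_neg,
    one_div]

/-! ## The reference tail `T(x) = (1 + |x|²)⁻²` and its Fourier transform `π² e^{-2π|ξ|}` -/

/-- `∫₀^∞ s^{-3} e^{-a/(4s)} ds = 16/a²` for `a > 0` (inversion `s = 1/y`, `Γ(2) = 1`). [folklore] -/
theorem integral_rpow_neg_three_exp {a : ℝ} (ha : 0 < a) :
    ∫ s in Ioi (0 : ℝ), s ^ (-(3 : ℝ)) * Real.exp (-(a / (4 * s))) = 16 / a ^ 2 := by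
  set g : ℝ → ℝ := fun s => s ^ (-(3 : ℝ)) * Real.exp (-(a / (4 * s))) with hg
  rw [show (∫ s in Ioi (0 : ℝ), s ^ (-(3 : ℝ)) * Real.exp (-(a / (4 * s)))) = ∫ s in Ioi 0, g s from rfl,
    ← integral_comp_rpow_Ioi g (p := -1) (by norm_num)]
  have h1 : ∀ x ∈ Ioi (0 : ℝ), (|(-1 : ℝ)| * x ^ ((-1 : ℝ) - 1)) • g (x ^ (-1 : ℝ)) =
      x ^ ((2 : ℝ) - 1) * Real.exp (-(a / 4 * x)) := by
    intro x hx
    have hx0 : 0 < x := hx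
    simp only [hg, smul_eq_mul, abs_neg, abs_one, one_mul, Real.rpow_neg_one]
    have e1 : (x⁻¹) ^ (-(3 : ℝ)) = x ^ (3 : ℝ) := by
      rw [Real.inv_rpow hx0.le, Real.rpow_neg hx0.le, inv_inv]
    have e2 : -(a / (4 * x⁻¹)) = -(a / 4 * x) := by field_simp
    rw [e1, e2, ← mul_assoc, ← Real.rpow_add hx0]
    norm_num
  rw [setIntegral_congr_fun measurableSet_Ioi h1,
    Real.integral_rpow_mul_exp_neg_mul_Ioi (by norm_num : (0 : ℝ) < 2) (by positivity : 0 < a / 4)]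
  have hG : Real.Gamma 2 = 1 := by
    rw [show (2 : ℝ) = 1 + 1 by norm_num, Real.Gamma_add_one one_ne_zero, Real.Gamma_one, mul_one]
  rw [hG, mul_one]
  have ha0 : a ≠ 0 := ha.ne'
  rw [one_div, inv_div, Real.rpow_two, div_pow, eq_div_iff (pow_ne_zero 2 ha0)]
  field_simp
  norm_num

/-- `∫₀^∞ s^{-3/2} e^{-1/(4s)} ds = 2√π` (inversion `s = 1/y`, `Γ(½) = √π`). [folklore] -/
theorem integral_rpow_neg_three_halves_exp_quarter :
    ∫ s in Ioi (0 : ℝ), s ^ (-(3 / 2 : ℝ)) * Real.exp (-(1 / (4 * s))) = 2 * Real.sqrt Real.pi := by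
  set g : ℝ → ℝ := fun s => s ^ (-(3 / 2 : ℝ)) * Real.exp (-(1 / (4 * s))) with hg
  rw [show (∫ s in Ioi (0 : ℝ), s ^ (-(3 / 2 : ℝ)) * Real.exp (-(1 / (4 * s)))) = ∫ s in Ioi 0, g s
    from rfl, ← integral_comp_rpow_Ioi g (p := -1) (by norm_num)]
  have h1 : ∀ x ∈ Ioi (0 : ℝ), (|(-1 : ℝ)| * x ^ ((-1 : ℝ) - 1)) • g (x ^ (-1 : ℝ)) =
      x ^ ((1 / 2 : ℝ) - 1) * Real.exp (-(1 / 4 * x)) := by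
    intro x hx
    have hx0 : 0 < x := hx
    simp only [hg, smul_eq_mul, abs_neg, abs_one, one_mul, Real.rpow_neg_one]
    have e1 : (x⁻¹) ^ (-(3 / 2 : ℝ)) = x ^ (3 / 2 : ℝ) := by
      rw [Real.inv_rpow hx0.le, Real.rpow_neg hx0.le, inv_inv]
    have e2 : -(1 / (4 * x⁻¹)) = -(1 / 4 * x) := by field_simp
    rw [e1, e2, ← mul_assoc, ← Real.rpow_add hx0]
    norm_num
  rw [setIntegral_congr_fun measurableSet_Ioi h1,
    Real.integral_rpow_mul_exp_neg_mul_Ioi (by norm_num : (0 : ℝ) < 1 / 2) (by norm_num : (0 : ℝ) < 1 / 4),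
    Real.Gamma_one_half_eq]
  rw [show ((1 : ℝ) / (1 / 4)) = 4 by norm_num, show (4 : ℝ) = 2 ^ (2 : ℝ) by norm_num, ← Real.rpow_mul (by norm_num)]
  norm_num

/-- The subordination weight of the reference tail: `w(s) = (π^{3/2}/2) s^{-3/2} e^{-1/(4s)}`, for
which `∫₀^∞ w(s) G_s(x) ds = (1 + |x|²)⁻²`. [folklore] -/
def poissonWeight (s : ℝ) : ℝ :=
  Real.pi ^ (3 / 2 : ℝ) / 2 * (s ^ (-(3 / 2 : ℝ)) * Real.exp (-(1 / (4 * s))))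

/-- `w ≥ 0`. [folklore] -/
theorem poissonWeight_nonneg {s : ℝ} (hs : 0 ≤ s) : 0 ≤ poissonWeight s := by
  unfold poissonWeight
  have : 0 ≤ s ^ (-(3 / 2 : ℝ)) := Real.rpow_nonneg hs _
  positivity

/-- `π^{3/2} = π √π`. [folklore] -/
theorem pi_rpow_three_halves : Real.pi ^ (3 / 2 : ℝ) = Real.pi * Real.sqrt Real.pi := by
  rw [show (3 / 2 : ℝ) = 1 + 1 / 2 by norm_num, Real.rpow_add Real.pi_pos, Real.rpow_one,
    Real.sqrt_eq_rpow]

/-- `∫₀^∞ w(s) ds = π²`. [folklore] -/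
theorem integral_poissonWeight : ∫ s in Ioi (0 : ℝ), poissonWeight s = Real.pi ^ 2 := by
  unfold poissonWeight
  rw [integral_const_mul, integral_rpow_neg_three_halves_exp_quarter, pi_rpow_three_halves]
  have h : Real.sqrt Real.pi * Real.sqrt Real.pi = Real.pi := Real.mul_self_sqrt Real.pi_pos.le
  nlinarith [h]

/-- `w` is integrable on `(0, ∞)`. [folklore] -/
theorem integrableOn_poissonWeight : IntegrableOn poissonWeight (Ioi 0) := by
  refine Integrable.of_integral_ne_zero ?_
  rw [integral_poissonWeight]
  positivity

/-- `w` is measurable. [folklore] -/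
theorem measurable_poissonWeight : Measurable poissonWeight := by
  unfold poissonWeight
  fun_prop

/-- **The reference tail** `T(x) := (1 + |x|²)⁻²` (`T(x) ∼ |x|⁻⁴`, and `𝓕T = π²e^{-2π|ξ|}`).
[folklore] -/
def refTail (x : Space) : ℝ :=
  ((1 + ‖x‖ ^ 2) ^ 2)⁻¹

/-- `0 < T`. [folklore] -/
theorem refTail_pos (x : Space) : 0 < refTail x := by
  unfold refTail; positivity

/-- `T ≤ 1`. [folklore] -/
theorem refTail_le_one (x : Space) : refTail x ≤ 1 := by
  unfold refTail
  rw [inv_le_one_iff₀]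
  right
  nlinarith [sq_nonneg ‖x‖]

/-- `T` is continuous. [folklore] -/
theorem continuous_refTail : Continuous refTail := by
  unfold refTail
  refine Continuous.inv₀ (by fun_prop) fun x => ?_
  positivity

/-- **`T = ∫₀^∞ w(s) G_s ds`**: `(1 + |x|²)⁻² = (π^{3/2}/2)∫₀^∞ s^{-3/2}e^{-1/(4s)}(4πs)^{-3/2}
e^{-|x|²/(4s)} ds`. [folklore] -/
theorem refTail_eq_mixture (x : Space) :
    refTail x = ∫ s in Ioi 0, poissonWeight s * heatKernel s x := by
  have ha : 0 < 1 + ‖x‖ ^ 2 := by positivity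
  have h1 : ∀ s ∈ Ioi (0 : ℝ), poissonWeight s * heatKernel s x =
      (1 / 16 : ℝ) * (s ^ (-(3 : ℝ)) * Real.exp (-((1 + ‖x‖ ^ 2) / (4 * s)))) := by
    intro s hs
    have hs0 : 0 < s := hs
    rw [poissonWeight, BoseGas.heatKernel_three, pi_rpow_three_halves]
    have e1 : (4 * Real.pi * s) ^ (-(3 / 2 : ℝ)) = (4 * Real.pi) ^ (-(3 / 2 : ℝ)) * s ^ (-(3 / 2 : ℝ)) :=
      Real.mul_rpow (by positivity) hs0.le
    have e2 : (4 * Real.pi) ^ (-(3 / 2 : ℝ)) = (8 * (Real.pi * Real.sqrt Real.pi))⁻¹ := by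
      rw [Real.rpow_neg (by positivity), Real.mul_rpow (by norm_num) Real.pi_pos.le,
        pi_rpow_three_halves, show (4 : ℝ) = 2 ^ (2 : ℝ) by norm_num, ← Real.rpow_mul (by norm_num)]
      norm_num
    have e3 : s ^ (-(3 / 2 : ℝ)) * s ^ (-(3 / 2 : ℝ)) = s ^ (-(3 : ℝ)) := by
      rw [← Real.rpow_add hs0]; norm_num
    have e4 : Real.exp (-(1 / (4 * s))) * Real.exp (-‖x‖ ^ 2 / (4 * s)) =
        Real.exp (-((1 + ‖x‖ ^ 2) / (4 * s))) := by
      rw [← Real.exp_add]; congr 1; field_simp; ring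
    have hπ : 0 < Real.pi * Real.sqrt Real.pi := by positivity
    calc Real.pi * Real.sqrt Real.pi / 2 * (s ^ (-(3 / 2 : ℝ)) * Real.exp (-(1 / (4 * s)))) *
          ((4 * Real.pi * s) ^ (-(3 / 2 : ℝ)) * Real.exp (-‖x‖ ^ 2 / (4 * s)))
        = Real.pi * Real.sqrt Real.pi / 2 * (4 * Real.pi) ^ (-(3 / 2 : ℝ)) *
            (s ^ (-(3 / 2 : ℝ)) * s ^ (-(3 / 2 : ℝ))) *
            (Real.exp (-(1 / (4 * s))) * Real.exp (-‖x‖ ^ 2 / (4 * s))) := by rw [e1]; ring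
      _ = (1 / 16 : ℝ) * (s ^ (-(3 : ℝ)) * Real.exp (-((1 + ‖x‖ ^ 2) / (4 * s)))) := by
          rw [e2, e3, e4]
          field_simp
          ring
  rw [setIntegral_congr_fun measurableSet_Ioi h1, integral_const_mul, integral_rpow_neg_three_exp ha,
    refTail]
  field_simp

/-- **`𝓕T(ξ) = π² e^{-2π|ξ|}`** (the Fourier transform of `(1 + |x|²)⁻²` on `ℝ³`, Mathlib
convention), by subordination: `∫₀^∞ w(s)e^{-4π²s|ξ|²}ds = (π^{3/2}/2)·√(4π)e^{-2π|ξ|}` (the tree's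
`Coulomb.lintegral_rpow_neg_three_halves_exp`). [folklore] -/
theorem fourier_refTail (ξ : Space) :
    𝓕 (fun x => (refTail x : ℂ)) ξ = ((Real.pi ^ 2 * Real.exp (-(2 * Real.pi * ‖ξ‖)) : ℝ) : ℂ) := by
  rw [fourier_heatKernel_mixture measurable_poissonWeight (fun s hs => poissonWeight_nonneg hs.le)
    integrableOn_poissonWeight (Eventually.of_forall refTail_eq_mixture) ξ]
  congr 1
  by_cases hξ : ξ = 0
  · -- `ξ = 0`: `∫₀^∞ w = π²`
    subst hξ
    simp only [heatSymbol, norm_zero, ne_eq, OfNat.ofNat_ne_zero, not_false_eq_true, zero_pow,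
      mul_zero, Real.exp_zero, mul_one, neg_zero]
    exact integral_poissonWeight
  · -- `ξ ≠ 0`: the classical integral `∫₀^∞ s^{-3/2}e^{-a/s-bs}ds = √(π/a)e^{-2√(ab)}`
    have hb : 0 < (2 * Real.pi) ^ 2 * ‖ξ‖ ^ 2 := by
      have := norm_pos_iff.2 hξ; positivity
    set b : ℝ := (2 * Real.pi) ^ 2 * ‖ξ‖ ^ 2 with hb_def
    have hint : ∀ s ∈ Ioi (0 : ℝ), poissonWeight s * heatSymbol s ξ = Real.pi ^ (3 / 2 : ℝ) / 2 *
        (s ^ (-(3 / 2 : ℝ)) * Real.exp (-((1 / 4) / s + b * s))) := by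
      intro s hs
      have hs0 : (0 : ℝ) < s := hs
      rw [poissonWeight, heatSymbol, hb_def, mul_assoc, mul_assoc, ← Real.exp_add]
      congr 3
      field_simp
      ring
    rw [setIntegral_congr_fun measurableSet_Ioi hint, integral_const_mul]
    -- the value of the classical integral, transported from `ℝ≥0∞`
    have hL := Coulomb.lintegral_rpow_neg_three_halves_exp (a := 1 / 4) (b := b) (by norm_num) hb
    have hnn : ∀ s ∈ Ioi (0 : ℝ), 0 ≤ s ^ (-(3 / 2 : ℝ)) * Real.exp (-((1 / 4) / s + b * s)) :=
      fun s hs => mul_nonneg (Real.rpow_nonneg (le_of_lt hs) _) (Real.exp_pos _).le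
    have hV : 0 ≤ Real.sqrt (Real.pi / (1 / 4)) * Real.exp (-(2 * Real.sqrt (1 / 4 * b))) := by positivity
    have hmeas : AEStronglyMeasurable (fun s : ℝ => s ^ (-(3 / 2 : ℝ)) * Real.exp (-((1 / 4) / s + b * s)))
        (volume.restrict (Ioi 0)) := by
      refine (Measurable.aestronglyMeasurable ?_)
      fun_prop
    have hI : ∫ s in Ioi (0 : ℝ), s ^ (-(3 / 2 : ℝ)) * Real.exp (-((1 / 4) / s + b * s)) =
        Real.sqrt (Real.pi / (1 / 4)) * Real.exp (-(2 * Real.sqrt (1 / 4 * b))) := by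
      rw [integral_eq_lintegral_of_nonneg_ae ((ae_restrict_iff' measurableSet_Ioi).2
        (Eventually.of_forall hnn)) hmeas, hL, ENNReal.toReal_ofReal hV]
    rw [hI]
    have e1 : Real.sqrt (Real.pi / (1 / 4)) = 2 * Real.sqrt Real.pi := by
      rw [show Real.pi / (1 / 4) = 2 ^ 2 * Real.pi by ring, Real.sqrt_mul (by norm_num), Real.sqrt_sq (by norm_num)]
    have e2 : Real.sqrt (1 / 4 * b) = Real.pi * ‖ξ‖ := by
      rw [hb_def, show 1 / 4 * ((2 * Real.pi) ^ 2 * ‖ξ‖ ^ 2) = (Real.pi * ‖ξ‖) ^ 2 by ring,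
        Real.sqrt_sq (by positivity)]
    rw [e1, e2, pi_rpow_three_halves]
    have h : Real.sqrt Real.pi * Real.sqrt Real.pi = Real.pi := Real.mul_self_sqrt Real.pi_pos.le
    calc Real.pi * Real.sqrt Real.pi / 2 * (2 * Real.sqrt Real.pi * Real.exp (-(2 * (Real.pi * ‖ξ‖))))
        = Real.pi * (Real.sqrt Real.pi * Real.sqrt Real.pi) * Real.exp (-(2 * (Real.pi * ‖ξ‖))) := by ring
      _ = Real.pi ^ 2 * Real.exp (-(2 * Real.pi * ‖ξ‖)) := by rw [h, mul_assoc 2]; ring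

/-- `T` is integrable (`𝓕T(0) = ∫T = π² ≠ 0`). [folklore] -/
theorem integrable_refTail : Integrable refTail := by
  refine Integrable.of_integral_ne_zero (fun h0 => ?_)
  have h := fourier_refTail 0
  rw [fourier_eq_integral_exp] at h
  have h2 : ∫ x, Complex.exp (↑(-2 * Real.pi * ⟪x, (0 : Space)⟫) * Complex.I) * (refTail x : ℂ) =
      ∫ x, (refTail x : ℂ) := by
    refine integral_congr_ae (Eventually.of_forall fun x => ?_)
    simp
  rw [h2, integral_complex_ofReal, h0, norm_zero, mul_zero, neg_zero, Real.exp_zero, mul_one] at h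
  have h3 : (0 : ℝ) = Real.pi ^ 2 := Complex.ofReal_injective h
  have h4 : (0 : ℝ) < Real.pi ^ 2 := by positivity
  exact h4.ne h3

/-! ## Real Fourier transforms of real, even functions; linearity -/

/-- The character-weighted integrand of `𝓕` is integrable when `f` is. [folklore] -/
theorem integrable_exp_mul_ofReal {f : Space → ℝ} (hf : Integrable f) (ξ : Space) :
    Integrable fun x => Complex.exp (↑(-2 * Real.pi * ⟪x, ξ⟫) * Complex.I) * (f x : ℂ) := by
  have hc : Continuous fun x : Space => Complex.exp (↑(-2 * Real.pi * ⟪x, ξ⟫) * Complex.I) := by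
    have : Continuous fun x : Space => ⟪x, ξ⟫ := continuous_inner.comp (continuous_id.prodMk continuous_const)
    fun_prop
  refine (hf.ofReal.bdd_mul (c := 1) hc.aestronglyMeasurable (Eventually.of_forall fun x => ?_))
  exact (Complex.norm_exp_ofReal_mul_I _).le

/-- `𝓕(f + g) = 𝓕f + 𝓕g` for real integrable `f, g`. [folklore] -/
theorem fourier_ofReal_add {f g : Space → ℝ} (hf : Integrable f) (hg : Integrable g) (ξ : Space) :
    𝓕 (fun x => ((f x + g x : ℝ) : ℂ)) ξ = 𝓕 (fun x => (f x : ℂ)) ξ + 𝓕 (fun x => (g x : ℂ)) ξ := by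
  simp only [fourier_eq_integral_exp]
  rw [← integral_add (integrable_exp_mul_ofReal hf ξ) (integrable_exp_mul_ofReal hg ξ)]
  refine integral_congr_ae (Eventually.of_forall fun x => ?_)
  push_cast
  ring

/-- `𝓕(f - g) = 𝓕f - 𝓕g` for real integrable `f, g`. [folklore] -/
theorem fourier_ofReal_sub {f g : Space → ℝ} (hf : Integrable f) (hg : Integrable g) (ξ : Space) :
    𝓕 (fun x => ((f x - g x : ℝ) : ℂ)) ξ = 𝓕 (fun x => (f x : ℂ)) ξ - 𝓕 (fun x => (g x : ℂ)) ξ := by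
  simp only [fourier_eq_integral_exp]
  rw [← integral_sub (integrable_exp_mul_ofReal hf ξ) (integrable_exp_mul_ofReal hg ξ)]
  refine integral_congr_ae (Eventually.of_forall fun x => ?_)
  push_cast
  ring

/-- `𝓕(c f) = c 𝓕f` for real `f` and a real constant `c`. [folklore] -/
theorem fourier_ofReal_const_mul (c : ℝ) (f : Space → ℝ) (ξ : Space) :
    𝓕 (fun x => ((c * f x : ℝ) : ℂ)) ξ = (c : ℂ) * 𝓕 (fun x => (f x : ℂ)) ξ := by
  simp only [fourier_eq_integral_exp]
  rw [← integral_const_mul]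
  refine integral_congr_ae (Eventually.of_forall fun x => ?_)
  push_cast
  ring

/-- `𝓕f(0) = ∫f`. [folklore] -/
theorem fourier_ofReal_zero (f : Space → ℝ) :
    𝓕 (fun x => (f x : ℂ)) 0 = ((∫ x, f x : ℝ) : ℂ) := by
  rw [fourier_eq_integral_exp, ← integral_complex_ofReal]
  refine integral_congr_ae (Eventually.of_forall fun x => ?_)
  simp

/-- `|𝓕f(ξ)| ≤ ∫|f|`. [folklore] -/
theorem norm_fourier_ofReal_le (f : Space → ℝ) (ξ : Space) :
    ‖𝓕 (fun x => (f x : ℂ)) ξ‖ ≤ ∫ x, |f x| := by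
  rw [fourier_eq_integral_exp]
  refine (norm_integral_le_integral_norm _).trans (le_of_eq ?_)
  refine integral_congr_ae (Eventually.of_forall fun x => ?_)
  simp only
  rw [norm_exp_mul (fun x => (f x : ℂ)) ξ x, Complex.norm_real, Real.norm_eq_abs]

/-- **The Fourier transform of a real even function is real**: `𝓕f(ξ) = conj 𝓕f(ξ)`, i.e.
`Im 𝓕f(ξ) = 0`, when `f(-x) = f(x)`. [folklore] -/
theorem fourier_ofReal_im_eq_zero {f : Space → ℝ} (hf : ∀ x, f (-x) = f x) (ξ : Space) :
    (𝓕 (fun x => (f x : ℂ)) ξ).im = 0 := by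
  have h1 : starRingEnd ℂ (𝓕 (fun x => (f x : ℂ)) ξ) = 𝓕 (fun x => (f x : ℂ)) (-ξ) := by
    rw [BoseGas.conj_fourier_ofReal, Real.fourierInv_eq_fourier_neg]
  have h2 : 𝓕 (fun x => (f x : ℂ)) (-ξ) = 𝓕 (fun x => (f x : ℂ)) ξ := by
    rw [fourier_eq_integral_exp, fourier_eq_integral_exp]
    have h3 : (fun x : Space => Complex.exp (↑(-2 * Real.pi * ⟪x, -ξ⟫) * Complex.I) * (f x : ℂ)) =
        fun x => (fun z : Space => Complex.exp (↑(-2 * Real.pi * ⟪z, ξ⟫) * Complex.I) * (f z : ℂ)) (-x) := by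
      funext x
      simp only [inner_neg_right, inner_neg_left, hf]
    rw [h3]
    exact integral_neg_eq_self
      (fun z : Space => Complex.exp (↑(-2 * Real.pi * ⟪z, ξ⟫) * Complex.I) * (f z : ℂ)) volume
  rw [h2] at h1
  exact Complex.conj_eq_iff_im.1 h1

/-- For a real even `f`: `𝓕f(ξ) = Re 𝓕f(ξ)` as a complex number. [folklore] -/
theorem fourier_ofReal_eq_re {f : Space → ℝ} (hf : ∀ x, f (-x) = f x) (ξ : Space) :
    𝓕 (fun x => (f x : ℂ)) ξ = ((𝓕 (fun x => (f x : ℂ)) ξ).re : ℂ) := by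
  apply Complex.ext
  · simp
  · simp [fourier_ofReal_im_eq_zero hf ξ]

/-- **`Re 𝓕f(ξ) = ∫ cos(2π⟪x,ξ⟫) f(x) dx`** for a real integrable `f`. [folklore] -/
theorem fourier_ofReal_re {f : Space → ℝ} (hf : Integrable f) (ξ : Space) :
    (𝓕 (fun x => (f x : ℂ)) ξ).re = ∫ x, Real.cos (2 * Real.pi * ⟪x, ξ⟫) * f x := by
  rw [fourier_eq_integral_exp, ← Complex.reCLM_apply, ← ContinuousLinearMap.integral_comp_comm _
    (integrable_exp_mul_ofReal hf ξ)]
  refine integral_congr_ae (Eventually.of_forall fun x => ?_)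
  simp only [Complex.reCLM_apply, Complex.re_mul_ofReal, Complex.exp_ofReal_mul_I_re]
  rw [show -2 * Real.pi * ⟪x, ξ⟫ = -(2 * Real.pi * ⟪x, ξ⟫) by ring, Real.cos_neg]

/-! ## Convolutions: the tree's `conv` and Mathlib's `⋆`; reflection invariance -/

/-- The tree's real convolution `conv f g`, coerced to `ℂ`, is Mathlib's convolution of the
coerced functions for the multiplication pairing. [folklore] -/
theorem ofReal_conv_eq (f g : Space → ℝ) :
    (fun x => ((conv f g x : ℝ) : ℂ)) =
      MeasureTheory.convolution (fun x => (f x : ℂ)) (fun x => (g x : ℂ)) (ContinuousLinearMap.mul ℂ ℂ) volume := by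
  funext x
  rw [conv_apply, convolution_def, ← integral_complex_ofReal]
  refine integral_congr_ae (Eventually.of_forall fun y => ?_)
  simp only [ContinuousLinearMap.mul_apply', Complex.ofReal_mul]

/-- `(f ∗ g)(-x) = (f ∗ (g ∘ neg))(x)` for an even `f`. [folklore] -/
theorem conv_neg_of_even {f : Space → ℝ} (hf : ∀ x, f (-x) = f x) (g : Space → ℝ) (x : Space) :
    conv f g (-x) = conv f (fun y => g (-y)) x := by
  rw [conv_apply, conv_apply]
  have h : (fun y => f y * g (-x - y)) = fun y => (fun z => f z * g (-(x - z))) (-y) := by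
    funext y
    simp only [hf]
    congr 2
    abel
  rw [h]
  exact integral_neg_eq_self (fun z : Space => f z * g (-(x - z))) volume

/-- `((u ∘ neg) ∗ (u ∘ neg))(y) = (u ∗ u)(-y)`. [folklore] -/
theorem conv_comp_neg (u : Space → ℝ) (y : Space) :
    conv (fun z => u (-z)) (fun z => u (-z)) y = conv u u (-y) := by
  rw [conv_apply, conv_apply]
  have h : (fun z => u (-z) * u (-(y - z))) = fun z => (fun w => u w * u (-y - w)) (-z) := by
    funext z
    congr 2
    abel
  rw [h]
  exact integral_neg_eq_self (fun w : Space => u w * u (-y - w)) volume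

/-- `Y_c` is even. [folklore] -/
theorem yukawa_neg (c : ℝ) (x : Space) : yukawa c (-x) = yukawa c x := by
  simp [yukawa, norm_neg]

/-- **Reflection invariance of the simple equation**: for an even potential, `x ↦ u(-x)` is a
solution at `(ρ, e)` whenever `u` is. [folklore] -/
theorem IsSolution.comp_neg {𝒱 : Space → ℝ} (h𝒱 : ∀ x, 𝒱 (-x) = 𝒱 x) {ρ e : ℝ} {u : Space → ℝ}
    (hu : IsSolution 𝒱 ρ e u) : IsSolution 𝒱 ρ e (fun x => u (-x)) where
  integrable := hu.integrable.comp_neg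
  nonneg := fun x => hu.nonneg _
  le_one := fun x => hu.le_one _
  mild := by
    intro x
    have h := hu.mild (-x)
    rw [conv_neg_of_even (yukawa_neg (4 * e)) _ x] at h
    simp only
    rw [h]
    congr 1
    funext y
    rw [h𝒱, conv_comp_neg]
  energy := by
    have h := hu.energy
    unfold EnergyConstraint at h ⊢
    rw [h]
    congr 1
    have h2 : (fun x => (1 - u (-x)) * 𝒱 x) = fun x => (fun z => (1 - u z) * 𝒱 z) (-x) := by
      funext x
      simp only [h𝒱]
    rw [h2]
    exact (integral_neg_eq_self (fun z : Space => (1 - u z) * 𝒱 z) volume).symm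

/-! ## The simple equation in Fourier space -/

/-- **The Fourier transform of the simple equation**:
`(4e + 4π²|ξ|²) û(ξ) = Ŝ(ξ) + 2eρ û(ξ)²`, `S = (1 - u)𝒱` (mild form `u = Y_{4e} ∗ (S + 2eρ u∗u)`,
the convolution theorem and `𝓕Y_{4e} = (4e + 4π²|ξ|²)⁻¹`). [cite: CarlenJauslinLieb2021, §1 (uhat)] -/
theorem IsSolution.fourier_eq {𝒱 : Space → ℝ} (h1 : Integrable 𝒱) {ρ e : ℝ} (he : 0 < e)
    {u : Space → ℝ} (hu : IsSolution 𝒱 ρ e u) (ξ : Space) :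
    ((4 * e + (2 * Real.pi) ^ 2 * ‖ξ‖ ^ 2 : ℝ) : ℂ) * 𝓕 (fun x => (u x : ℂ)) ξ =
      𝓕 (fun x => (((1 - u x) * 𝒱 x : ℝ) : ℂ)) ξ +
        2 * e * ρ * (𝓕 (fun x => (u x : ℂ)) ξ) ^ 2 := by
  set F : Space → ℝ := fun y => (1 - u y) * 𝒱 y + 2 * e * ρ * conv u u y with hF
  have hS : Integrable fun y => (1 - u y) * 𝒱 y := hu.integrable_one_sub_mul h1
  obtain ⟨huu, -⟩ := integral_conv_self hu.integrable
  have hFi : Integrable F := hS.add (huu.const_mul _)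
  have hY : Integrable (yukawa (4 * e)) := integrable_yukawa (by positivity)
  -- `u = Y ∗ F`, so `û = Ŷ · F̂`
  have hu_eq : (fun x => (u x : ℂ)) = fun x => ((conv (yukawa (4 * e)) F x : ℝ) : ℂ) :=
    funext fun x => by rw [hu.mild x]
  have hconv : 𝓕 (fun x => (u x : ℂ)) ξ =
      𝓕 (fun x => (yukawa (4 * e) x : ℂ)) ξ * 𝓕 (fun x => (F x : ℂ)) ξ := by
    rw [hu_eq, ofReal_conv_eq]
    exact Real.fourier_mul_convolution_eq hY.ofReal hFi.ofReal ξ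
  -- `𝓕(u∗u) = û²`
  have huu2 : 𝓕 (fun x => ((conv u u x : ℝ) : ℂ)) ξ = (𝓕 (fun x => (u x : ℂ)) ξ) ^ 2 := by
    rw [ofReal_conv_eq, sq]
    exact Real.fourier_mul_convolution_eq hu.integrable.ofReal hu.integrable.ofReal ξ
  -- `F̂ = Ŝ + 2eρ û²`
  have hFF : 𝓕 (fun x => (F x : ℂ)) ξ = 𝓕 (fun x => (((1 - u x) * 𝒱 x : ℝ) : ℂ)) ξ +
      2 * e * ρ * (𝓕 (fun x => (u x : ℂ)) ξ) ^ 2 := by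
    rw [hF]
    simp only
    rw [fourier_ofReal_add hS (huu.const_mul _), fourier_ofReal_const_mul, huu2]
    push_cast
    ring
  have hc : (4 * e + (2 * Real.pi) ^ 2 * ‖ξ‖ ^ 2 : ℝ) ≠ 0 := by positivity
  calc ((4 * e + (2 * Real.pi) ^ 2 * ‖ξ‖ ^ 2 : ℝ) : ℂ) * 𝓕 (fun x => (u x : ℂ)) ξ
      = ((4 * e + (2 * Real.pi) ^ 2 * ‖ξ‖ ^ 2 : ℝ) : ℂ) *
          (𝓕 (fun x => (yukawa (4 * e) x : ℂ)) ξ * 𝓕 (fun x => (F x : ℂ)) ξ) := by rw [← hconv]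
    _ = 𝓕 (fun x => (F x : ℂ)) ξ := by
        rw [fourier_yukawa (by positivity : 0 < 4 * e), ← mul_assoc, ← Complex.ofReal_mul,
          mul_inv_cancel₀ hc, Complex.ofReal_one, one_mul]
    _ = _ := hFF

/-- **`ρû = A − √(A² − (ρ/2e)Ŝ)`, `A = 1 + π²|ξ|²/e`** (Mathlib convention; CJL-II (uhat) with
`k = 2πξ`): the quadratic `2eρû² − (4e + 4π²|ξ|²)û + Ŝ = 0` from `IsSolution.fourier_eq`, for an
even solution (`û`, `Ŝ` real), and the root is selected by `ρû ≤ ρ∫u = 1 ≤ A` — no continuity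
argument is needed. [cite: CarlenJauslinLieb2021, §1 (uhat)] -/
theorem IsSolution.rho_mul_fourier_re_eq {𝒱 : Space → ℝ} (h1 : Integrable 𝒱)
    (h𝒱 : ∀ x, 𝒱 (-x) = 𝒱 x) {ρ e : ℝ} (hρ : 0 < ρ) (he : 0 < e) {u : Space → ℝ}
    (hu : IsSolution 𝒱 ρ e u) (heven : ∀ x, u (-x) = u x) (ξ : Space) :
    ρ * (𝓕 (fun x => (u x : ℂ)) ξ).re =
      (1 + Real.pi ^ 2 * ‖ξ‖ ^ 2 / e) -
        Real.sqrt ((1 + Real.pi ^ 2 * ‖ξ‖ ^ 2 / e) ^ 2 -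
          ρ / (2 * e) * (𝓕 (fun x => (((1 - u x) * 𝒱 x : ℝ) : ℂ)) ξ).re) := by
  have hSeven : ∀ x, (fun x => (1 - u x) * 𝒱 x) (-x) = (fun x => (1 - u x) * 𝒱 x) x := by
    intro x; simp only [heven, h𝒱]
  have hu_re := fourier_ofReal_eq_re heven ξ
  have hS_re := fourier_ofReal_eq_re (f := fun y => (1 - u y) * 𝒱 y) hSeven ξ
  have hC := hu.fourier_eq h1 he ξ
  rw [hu_re, hS_re] at hC
  set Y : ℝ := (𝓕 (fun x => (u x : ℂ)) ξ).re with hY_def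
  set T : ℝ := (𝓕 (fun x => (((1 - u x) * 𝒱 x : ℝ) : ℂ)) ξ).re with hT_def
  -- the real quadratic identity
  have hR : (4 * e + (2 * Real.pi) ^ 2 * ‖ξ‖ ^ 2) * Y = T + 2 * e * ρ * Y ^ 2 := by
    exact_mod_cast hC
  -- the bound `ρ Re û ≤ ρ ∫u = 1`
  have hbound : ρ * Y ≤ 1 := by
    have h2 : Y ≤ ‖𝓕 (fun x => (u x : ℂ)) ξ‖ := Complex.re_le_norm _
    have h3 : ‖𝓕 (fun x => (u x : ℂ)) ξ‖ ≤ ∫ x, |u x| := norm_fourier_ofReal_le u ξ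
    have h4 : ∫ x, |u x| = 1 / ρ := by
      rw [← hu.integral_eq h1 hρ he]
      exact integral_congr_ae (Eventually.of_forall fun x => abs_of_nonneg (hu.nonneg x))
    calc ρ * Y ≤ ρ * (1 / ρ) := by
          exact mul_le_mul_of_nonneg_left (h2.trans (h3.trans h4.le)) hρ.le
      _ = 1 := by field_simp
  obtain ⟨A, hA_def⟩ : ∃ A : ℝ, A = 1 + Real.pi ^ 2 * ‖ξ‖ ^ 2 / e := ⟨_, rfl⟩
  rw [← hA_def]
  have hA : 1 ≤ A := by
    rw [hA_def]
    have : 0 ≤ Real.pi ^ 2 * ‖ξ‖ ^ 2 / e := by positivity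
    linarith
  have key : (A - ρ * Y) ^ 2 = A ^ 2 - ρ / (2 * e) * T := by
    have he0 : e ≠ 0 := he.ne'
    have hA4 : 4 * e * A = 4 * e + (2 * Real.pi) ^ 2 * ‖ξ‖ ^ 2 := by
      rw [hA_def]; field_simp; ring
    -- `4eA·Y = T + 2eρY²`, i.e. `(ρY)² − 2A(ρY) + (ρ/2e)T = 0`
    have h5 : 4 * e * A * Y = T + 2 * e * ρ * Y ^ 2 := by rw [hA4]; exact hR
    have h6 : ρ / (2 * e) * T = 2 * A * (ρ * Y) - (ρ * Y) ^ 2 := by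
      have hT : T = 4 * e * A * Y - 2 * e * ρ * Y ^ 2 := by linarith
      rw [hT]
      field_simp
      ring
    rw [h6]
    ring
  have hnn : 0 ≤ A - ρ * Y := by linarith
  calc ρ * Y = A - (A - ρ * Y) := by ring
    _ = A - Real.sqrt ((A - ρ * Y) ^ 2) := by rw [Real.sqrt_sq hnn]
    _ = A - Real.sqrt (A ^ 2 - ρ / (2 * e) * T) := by rw [key]

/-! ## Two elementary limits and a dominated-convergence lemma -/

/-- `(1 − cos(bt))/t² → b²/2` as `t → 0`. [folklore] -/
theorem tendsto_one_sub_cos_div_sq (b : ℝ) :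
    Tendsto (fun t : ℝ => (1 - Real.cos (b * t)) / t ^ 2) (𝓝[≠] 0) (𝓝 (b ^ 2 / 2)) := by
  have key : ∀ t : ℝ, t ≠ 0 → |b * t| ≤ 1 →
      |(1 - Real.cos (b * t)) / t ^ 2 - b ^ 2 / 2| ≤ 5 / 96 * b ^ 4 * t ^ 2 := by
    intro t ht hbt
    have h := Real.cos_bound hbt
    have ht2 : 0 < t ^ 2 := by positivity
    have e1 : (1 - Real.cos (b * t)) / t ^ 2 - b ^ 2 / 2 =
        -(Real.cos (b * t) - (1 - (b * t) ^ 2 / 2)) / t ^ 2 := by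
      field_simp; ring
    rw [e1, abs_div, abs_neg, abs_of_pos ht2, div_le_iff₀ ht2]
    calc |Real.cos (b * t) - (1 - (b * t) ^ 2 / 2)| ≤ |b * t| ^ 4 * (5 / 96) := h
      _ = 5 / 96 * b ^ 4 * t ^ 2 * t ^ 2 := by rw [pow_abs, abs_of_nonneg (by positivity)]; ring
  have hsmall : ∀ᶠ t : ℝ in 𝓝[≠] 0, t ≠ 0 ∧ |b * t| ≤ 1 := by
    have h0 : ∀ᶠ t : ℝ in 𝓝[≠] 0, t ≠ 0 := eventually_mem_nhdsWithin
    have hc : Tendsto (fun t : ℝ => b * t) (𝓝 0) (𝓝 0) := by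
      have h : Continuous (fun t : ℝ => b * t) := by fun_prop
      simpa using h.tendsto 0
    have h1 : ∀ᶠ t : ℝ in 𝓝 0, |b * t| ≤ 1 := by
      have := hc (Metric.closedBall_mem_nhds (0 : ℝ) one_pos)
      filter_upwards [this] with t ht
      simpa [Real.dist_eq] using ht
    exact h0.and (nhdsWithin_le_nhds h1)
  have hzero : Tendsto (fun t : ℝ => (1 - Real.cos (b * t)) / t ^ 2 - b ^ 2 / 2) (𝓝[≠] 0) (𝓝 0) := by
    refine squeeze_zero_norm' (a := fun t => 5 / 96 * b ^ 4 * t ^ 2) (hsmall.mono fun t ht => ?_) ?_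
    · exact (Real.norm_eq_abs _).le.trans (key t ht.1 ht.2)
    · have : Tendsto (fun t : ℝ => 5 / 96 * b ^ 4 * t ^ 2) (𝓝 0) (𝓝 (5 / 96 * b ^ 4 * 0 ^ 2)) :=
        ((continuous_const.mul (continuous_pow 2)).tendsto 0)
      simp only [ne_eq, OfNat.ofNat_ne_zero, not_false_eq_true, zero_pow, mul_zero] at this
      exact tendsto_nhdsWithin_of_tendsto_nhds this
  have := hzero.add_const (b ^ 2 / 2)
  simpa using this

/-- `(1 − e^{-as})/s → a` as `s → 0` (`s ≠ 0`; used for `s = |t|`), for `a > 0`. [folklore] -/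
theorem tendsto_one_sub_exp_div (a : ℝ) :
    Tendsto (fun s : ℝ => (1 - Real.exp (-(a * s))) / s) (𝓝[≠] 0) (𝓝 a) := by
  have key : ∀ s : ℝ, s ≠ 0 → |a * s| ≤ 1 →
      abs ((1 - Real.exp (-(a * s))) / s - a) ≤ a ^ 2 * abs s := by
    intro s hs has
    have hs0 : 0 < abs s := abs_pos.2 hs
    have h := Real.abs_exp_sub_one_sub_id_le (x := -(a * s)) (by rw [abs_neg]; exact has)
    have e1 : (1 - Real.exp (-(a * s))) / s - a = -((Real.exp (-(a * s)) - 1 - -(a * s)) / s) := by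
      field_simp; ring
    rw [e1, abs_neg, abs_div, div_le_iff₀ hs0]
    calc abs (Real.exp (-(a * s)) - 1 - -(a * s)) ≤ (-(a * s)) ^ 2 := h
      _ = a ^ 2 * abs s * abs s := by
          rw [show (-(a * s)) ^ 2 = a ^ 2 * s ^ 2 by ring, ← sq_abs s]; ring
  have hsmall : ∀ᶠ s : ℝ in 𝓝[≠] 0, s ≠ 0 ∧ |a * s| ≤ 1 := by
    have h0 : ∀ᶠ s : ℝ in 𝓝[≠] 0, s ≠ 0 := eventually_mem_nhdsWithin
    have hc : Tendsto (fun s : ℝ => a * s) (𝓝 0) (𝓝 0) := by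
      have h : Continuous (fun s : ℝ => a * s) := by fun_prop
      simpa using h.tendsto 0
    have h1 : ∀ᶠ s : ℝ in 𝓝 0, |a * s| ≤ 1 := by
      have := hc (Metric.closedBall_mem_nhds (0 : ℝ) one_pos)
      filter_upwards [this] with s hs
      simpa [Real.dist_eq] using hs
    exact h0.and (nhdsWithin_le_nhds h1)
  have hzero : Tendsto (fun s : ℝ => (1 - Real.exp (-(a * s))) / s - a) (𝓝[≠] 0) (𝓝 0) := by
    refine squeeze_zero_norm' (a := fun s => a ^ 2 * abs s) (hsmall.mono fun s hs => ?_) ?_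
    · exact (Real.norm_eq_abs _).le.trans (key s hs.1 hs.2)
    · have : Tendsto (fun s : ℝ => a ^ 2 * abs s) (𝓝 0) (𝓝 (a ^ 2 * abs 0)) :=
        ((continuous_const.mul continuous_abs).tendsto 0)
      simp only [abs_zero, mul_zero] at this
      exact tendsto_nhdsWithin_of_tendsto_nhds this
  have := hzero.add_const a
  simpa using this

/-- `t ↦ |t|` maps `𝓝[≠] 0` to `𝓝[≠] 0`. [folklore] -/
theorem tendsto_abs_nhdsNE_zero : Tendsto (fun t : ℝ => |t|) (𝓝[≠] 0) (𝓝[≠] (0 : ℝ)) := by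
  refine tendsto_nhdsWithin_of_tendsto_nhds_of_eventually_within _ ?_ ?_
  · have := (continuous_abs.tendsto (0 : ℝ))
    simp only [abs_zero] at this
    exact tendsto_nhdsWithin_of_tendsto_nhds this
  · filter_upwards [eventually_mem_nhdsWithin] with t ht
    simpa using ht

/-- The inner product with a fixed vector is continuous. [folklore] -/
theorem continuous_inner_const (η : Space) : Continuous fun x : Space => ⟪x, η⟫ :=
  continuous_inner.comp (continuous_id.prodMk continuous_const)

/-- **Second-order expansion of a real Fourier transform along a ray** (dominated convergence):
`∫ (1 − cos(a t ⟪x,η⟫))/t² g(x) dx → ∫ (a²/2)⟪x,η⟫² g(x) dx` as `t → 0`, for `g` and `⟪x,η⟫²g`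
integrable. [folklore] -/
theorem tendsto_integral_one_sub_cos_div_sq {g : Space → ℝ} (η : Space) (a : ℝ)
    (hg : Integrable g) (hg2 : Integrable fun x => ⟪x, η⟫ ^ 2 * g x) :
    Tendsto (fun t : ℝ => ∫ x, (1 - Real.cos (a * t * ⟪x, η⟫)) / t ^ 2 * g x) (𝓝[≠] 0)
      (𝓝 (∫ x, a ^ 2 / 2 * ⟪x, η⟫ ^ 2 * g x)) := by
  refine tendsto_integral_filter_of_dominated_convergence (fun x => a ^ 2 / 2 * ⟪x, η⟫ ^ 2 * |g x|)
    ?_ ?_ ?_ ?_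
  · refine Eventually.of_forall fun t => ?_
    have hc : Continuous fun x : Space => (1 - Real.cos (a * t * ⟪x, η⟫)) / t ^ 2 := by
      have := continuous_inner_const η
      fun_prop
    exact hc.aestronglyMeasurable.mul hg.aestronglyMeasurable
  · refine eventually_nhdsWithin_of_forall fun t ht => Eventually.of_forall fun x => ?_
    have ht' : t ≠ 0 := ht
    have ht2 : 0 < t ^ 2 := by positivity
    have h1 : 0 ≤ 1 - Real.cos (a * t * ⟪x, η⟫) := by linarith [Real.cos_le_one (a * t * ⟪x, η⟫)]
    have h2 : 1 - Real.cos (a * t * ⟪x, η⟫) ≤ (a * t * ⟪x, η⟫) ^ 2 / 2 := by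
      linarith [Real.one_sub_sq_div_two_le_cos (x := a * t * ⟪x, η⟫)]
    rw [Real.norm_eq_abs, abs_mul, abs_div, abs_of_nonneg h1, abs_of_pos ht2]
    calc (1 - Real.cos (a * t * ⟪x, η⟫)) / t ^ 2 * |g x| ≤ (a * t * ⟪x, η⟫) ^ 2 / 2 / t ^ 2 * |g x| := by
          gcongr
      _ = a ^ 2 / 2 * ⟪x, η⟫ ^ 2 * |g x| := by field_simp
  · have h : Integrable (fun x => a ^ 2 / 2 * (⟪x, η⟫ ^ 2 * |g x|)) := by
      refine ((hg2.norm).const_mul (a ^ 2 / 2)).congr (Eventually.of_forall fun x => ?_)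
      change a ^ 2 / 2 * ‖⟪x, η⟫ ^ 2 * g x‖ = a ^ 2 / 2 * (⟪x, η⟫ ^ 2 * |g x|)
      rw [Real.norm_eq_abs, abs_mul, abs_pow, sq_abs]
    exact h.congr (Eventually.of_forall fun x => by simp only; ring)
  · refine Eventually.of_forall fun x => ?_
    have h := (tendsto_one_sub_cos_div_sq (a * ⟪x, η⟫)).mul_const (g x)
    rw [show (a * ⟪x, η⟫) ^ 2 / 2 * g x = a ^ 2 / 2 * ⟪x, η⟫ ^ 2 * g x by ring] at h
    refine h.congr' (Eventually.of_forall fun t => ?_)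
    change (1 - Real.cos (a * ⟪x, η⟫ * t)) / t ^ 2 * g x = (1 - Real.cos (a * t * ⟪x, η⟫)) / t ^ 2 * g x
    rw [mul_right_comm]

/-! ## Weighted integrability from `|x|⁴R ∈ L²` -/

/-- `x ↦ (1 + |x|)⁻⁴` is integrable on `ℝ³`. [folklore] -/
theorem integrable_inv_one_add_norm_pow_four :
    Integrable fun x : Space => ((1 + ‖x‖) ^ 4)⁻¹ := by
  have h := integrable_one_add_norm (E := Space) (μ := volume) (r := 4)
    (by rw [finrank_euclideanSpace_fin]; norm_num)
  refine h.congr (Eventually.of_forall fun x => ?_)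
  simp only
  rw [Real.rpow_neg (by positivity), show (4 : ℝ) = ((4 : ℕ) : ℝ) by norm_num, Real.rpow_natCast]

/-- `x ↦ (1 + |x|)⁻²` is square-integrable on `ℝ³`. [folklore] -/
theorem memLp_two_inv_one_add_norm_sq :
    MemLp (fun x : Space => ((1 + ‖x‖) ^ 2)⁻¹) 2 := by
  have hm : AEStronglyMeasurable (fun x : Space => ((1 + ‖x‖) ^ 2)⁻¹) volume := by
    refine (Continuous.inv₀ (by fun_prop) fun x => ?_).aestronglyMeasurable
    positivity
  rw [memLp_two_iff_integrable_sq hm]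
  refine integrable_inv_one_add_norm_pow_four.congr (Eventually.of_forall fun x => ?_)
  simp only
  rw [← inv_pow, ← inv_pow, ← pow_mul]

/-- **Second moments from `|x|⁴R ∈ L²`**: a bounded, a.e.-strongly measurable `R` on `ℝ³` with
`|x|⁴R ∈ L²` has `(1 + |x|²)R ∈ L¹` (bounded on the unit ball; outside,
`(1 + |x|²)|R| ≤ 8(1 + |x|)⁻²·||x|⁴R|`, a product of two `L²` functions). [folklore] -/
theorem integrable_one_add_norm_sq_mul {R : Space → ℝ} (hm : AEStronglyMeasurable R volume) {C : ℝ}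
    (hC : ∀ x, |R x| ≤ C) (h2 : MemLp (fun x => ‖x‖ ^ 4 * R x) 2) :
    Integrable fun x => (1 + ‖x‖ ^ 2) * R x := by
  have hC0 : 0 ≤ C := (abs_nonneg _).trans (hC 0)
  set g : Space → ℝ := fun x => ‖x‖ ^ 4 * R x with hg
  set k : Space → ℝ := fun x => ((1 + ‖x‖) ^ 2)⁻¹ with hk
  -- the majorant
  set D : Space → ℝ := fun x => 32 * C * ((1 + ‖x‖) ^ 4)⁻¹ + 8 * (k x * |g x|) with hD
  have hDi : Integrable D := by
    refine (integrable_inv_one_add_norm_pow_four.const_mul (32 * C)).add (Integrable.const_mul ?_ 8)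
    have hprod : Integrable (k * fun x => |g x|) := memLp_two_inv_one_add_norm_sq.integrable_mul h2.abs
    exact hprod
  refine hDi.mono' ((Continuous.aestronglyMeasurable (by fun_prop)).mul hm)
    (Eventually.of_forall fun x => ?_)
  rw [Real.norm_eq_abs, abs_mul, abs_of_nonneg (by positivity)]
  have hk0 : 0 ≤ k x := by rw [hk]; positivity
  have hg0 : 0 ≤ |g x| := abs_nonneg _
  have h4pos : 0 < (1 + ‖x‖) ^ 4 := by positivity
  by_cases hx : ‖x‖ ≤ 1
  · -- on the unit ball: `(1 + |x|²)|R| ≤ 2C ≤ 32C(1 + |x|)⁻⁴`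
    have h1 : (1 + ‖x‖ ^ 2) * |R x| ≤ 2 * C := by
      have : ‖x‖ ^ 2 ≤ 1 := pow_le_one₀ (norm_nonneg x) hx
      nlinarith [hC x, abs_nonneg (R x)]
    have h2' : (1 + ‖x‖) ^ 4 ≤ 16 := by
      have : 1 + ‖x‖ ≤ 2 := by linarith
      calc (1 + ‖x‖) ^ 4 ≤ 2 ^ 4 := pow_le_pow_left₀ (by positivity) this 4
        _ = 16 := by norm_num
    have h3 : 2 * C ≤ 32 * C * ((1 + ‖x‖) ^ 4)⁻¹ := by
      rw [show 32 * C * ((1 + ‖x‖) ^ 4)⁻¹ = 2 * C * (16 / (1 + ‖x‖) ^ 4) by ring]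
      have : 1 ≤ 16 / (1 + ‖x‖) ^ 4 := by rw [le_div_iff₀ h4pos]; linarith
      nlinarith
    calc (1 + ‖x‖ ^ 2) * |R x| ≤ 32 * C * ((1 + ‖x‖) ^ 4)⁻¹ := h1.trans h3
      _ ≤ D x := by rw [hD]; simp only; nlinarith
  · -- outside: `(1 + |x|²)|R| = (1 + |x|²)|x|⁻⁴ ||x|⁴R| ≤ 8(1 + |x|)⁻² ||x|⁴R|`
    push Not at hx
    have hx4 : 0 < ‖x‖ ^ 4 := by positivity
    have h1 : |R x| = |g x| / ‖x‖ ^ 4 := by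
      rw [hg]; simp only; rw [abs_mul, abs_of_pos hx4]; field_simp
    have h2' : (1 + ‖x‖ ^ 2) * (1 + ‖x‖) ^ 2 ≤ 8 * ‖x‖ ^ 4 := by
      have ha : 1 + ‖x‖ ^ 2 ≤ 2 * ‖x‖ ^ 2 := by nlinarith
      have hb : (1 + ‖x‖) ^ 2 ≤ (2 * ‖x‖) ^ 2 := pow_le_pow_left₀ (by positivity) (by linarith) 2
      calc (1 + ‖x‖ ^ 2) * (1 + ‖x‖) ^ 2 ≤ (2 * ‖x‖ ^ 2) * (2 * ‖x‖) ^ 2 :=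
            mul_le_mul ha hb (by positivity) (by positivity)
        _ = 8 * ‖x‖ ^ 4 := by ring
    have h3 : (1 + ‖x‖ ^ 2) * |R x| ≤ 8 * (k x * |g x|) := by
      rw [h1, hk]
      simp only
      have h2pos : 0 < (1 + ‖x‖) ^ 2 := by positivity
      rw [mul_div_assoc', div_le_iff₀ hx4, show 8 * (((1 + ‖x‖) ^ 2)⁻¹ * |g x|) * ‖x‖ ^ 4 =
        (8 * ‖x‖ ^ 4 / (1 + ‖x‖) ^ 2) * |g x| by field_simp]
      refine mul_le_mul_of_nonneg_right ?_ hg0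
      rw [le_div_iff₀ h2pos]
      exact h2'
    calc (1 + ‖x‖ ^ 2) * |R x| ≤ 8 * (k x * |g x|) := h3
      _ ≤ D x := by
          rw [hD]; simp only
          have : 0 ≤ 32 * C * ((1 + ‖x‖) ^ 4)⁻¹ := by positivity
          linarith

/-- The Fourier transform along a ray of a real function with second moments moves by `O(t²)`:
`|Re 𝓕R(tη) − Re 𝓕R(0)| ≤ 2π²t²∫⟪x,η⟫²|R|`. [folklore] -/
theorem abs_fourier_re_sub_le {R : Space → ℝ} (η : Space) (hR : Integrable R)
    (hR2 : Integrable fun x => ⟪x, η⟫ ^ 2 * R x) (t : ℝ) :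
    |(𝓕 (fun x => (R x : ℂ)) (t • η)).re - (𝓕 (fun x => (R x : ℂ)) 0).re| ≤
      2 * Real.pi ^ 2 * t ^ 2 * ∫ x, ⟪x, η⟫ ^ 2 * |R x| := by
  rw [fourier_ofReal_re hR, fourier_ofReal_re hR, ← integral_sub]
  · rw [← integral_const_mul, ← Real.norm_eq_abs]
    refine norm_integral_le_of_norm_le ((hR2.norm.const_mul (2 * Real.pi ^ 2 * t ^ 2)).congr
      (Eventually.of_forall fun x => ?_)) (Eventually.of_forall fun x => ?_)
    · simp only [Real.norm_eq_abs, abs_mul, abs_pow, sq_abs]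
    · simp only [inner_smul_right, inner_zero_right, mul_zero, Real.cos_zero, one_mul]
      rw [Real.norm_eq_abs, show Real.cos (2 * Real.pi * (t * ⟪x, η⟫)) * R x - R x =
        (Real.cos (2 * Real.pi * (t * ⟪x, η⟫)) - 1) * R x by ring, abs_mul]
      have h1 : |Real.cos (2 * Real.pi * (t * ⟪x, η⟫)) - 1| ≤ (2 * Real.pi * (t * ⟪x, η⟫)) ^ 2 / 2 := by
        rw [abs_sub_comm, abs_of_nonneg (by linarith [Real.cos_le_one (2 * Real.pi * (t * ⟪x, η⟫))])]
        linarith [Real.one_sub_sq_div_two_le_cos (x := 2 * Real.pi * (t * ⟪x, η⟫))]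
      calc |Real.cos (2 * Real.pi * (t * ⟪x, η⟫)) - 1| * |R x|
          ≤ (2 * Real.pi * (t * ⟪x, η⟫)) ^ 2 / 2 * |R x| := mul_le_mul_of_nonneg_right h1 (abs_nonneg _)
        _ = 2 * Real.pi ^ 2 * t ^ 2 * (⟪x, η⟫ ^ 2 * |R x|) := by ring
  · have hc : Continuous fun x : Space => Real.cos (2 * Real.pi * ⟪x, t • η⟫) := by
      have := continuous_inner_const (t • η); fun_prop
    exact hR.bdd_mul (c := 1) hc.aestronglyMeasurable
      (Eventually.of_forall fun x => by rw [Real.norm_eq_abs]; exact Real.abs_cos_le_one _)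
  · refine hR.congr (Eventually.of_forall fun x => ?_)
    simp

/-! ## The main theorem: the `|x|⁻⁴` tail coefficient of an even solution is `√(2+β/3)/(2π²√e)` -/

/-- Off the origin, a.e. [folklore] -/
theorem ae_ne_zero : ∀ᵐ x ∂(volume : Measure Space), x ≠ 0 := by
  have : (volume : Measure Space) {x | ¬x ≠ 0} = 0 := by
    simp only [ne_eq, not_not, setOf_eq_eq_singleton, measure_singleton]
  exact ae_iff.2 this

/-- `⟪x, η⟫² ≤ |x|²` for a unit vector `η`. [folklore] -/
theorem inner_sq_le_norm_sq (x : Space) {η : Space} (hη : ‖η‖ = 1) : ⟪x, η⟫ ^ 2 ≤ ‖x‖ ^ 2 := by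
  have h := abs_real_inner_le_norm x η
  rw [hη, mul_one] at h
  calc ⟪x, η⟫ ^ 2 = |⟪x, η⟫| ^ 2 := (sq_abs _).symm
    _ ≤ ‖x‖ ^ 2 := pow_le_pow_left₀ (abs_nonneg _) h 2

/-- **Main theorem (the tail coefficient is forced).** Let `v` be a CJL-II potential and
`(ρ, e, u)`, `ρ, e > 0`, an EVEN solution triple of the simple equation, and suppose that for some
real constant `c'` the remainder `R = ρu − c'|x|⁻⁴` has `|x|⁴R ∈ L²(ℝ³)` (the shape of the decay
statement of CJL-II Theorem 2). Then necessarily `c' ≥ 0` and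
`c'² = (2 + (ρ/3)∫|x|²(1 − u)v)/(4π⁴e)`, i.e. `c' = √(2 + β/3)/(2π²√e)` with the PRINTED
`β = ρ∫|x|²v(1 − u)` — one third of the printed `β` enters. Proof (module docstring): for every
unit vector `η`, compare the two expansions of `ρû(tη)` as `t → 0` — from the Fourier-transformed
equation `1 − ρû(tη) ∼ (π/√e)√(2 + ρ∫⟪x,η⟫²S)|t|` (`S = (1 − u)v`), and from `ρu = c'T + R'` with
`𝓕T = π²e^{-2π|ξ|}` and `𝓕R'` moving by `O(t²)` along the ray, `1 − ρû(tη) ∼ 2π³c'|t|`; hence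
`∫⟪x,η⟫²S = (4π⁴ec'² − 2)/ρ` for every `η`, and summing over an orthonormal basis gives the claim.
[cite: CarlenJauslinLieb2021, Theorem 2 and §2 (proof)] -/
theorem IsSolution.tail_coefficient_sq_eq {v : Space → ℝ} (hv : IsWeightedPotential v)
    {ρ e : ℝ} (hρ : 0 < ρ) (he : 0 < e) {u : Space → ℝ} (hu : IsSolution v ρ e u)
    (heven : ∀ x, u (-x) = u x) {c' : ℝ}
    (hL2 : MemLp (fun x => ‖x‖ ^ 4 * (ρ * u x - c' / ‖x‖ ^ 4)) 2) :
    0 ≤ c' ∧ c' ^ 2 = (2 + ρ / 3 * ∫ x, ‖x‖ ^ 2 * ((1 - u x) * v x)) / (4 * Real.pi ^ 4 * e) := by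
  have h0 := hv.nonneg
  have h1 := hv.integrable_self
  have hveven : ∀ x, v (-x) = v x := fun x => hv.radial (norm_neg x)
  have hρ0 : ρ ≠ 0 := hρ.ne'
  have he0 : e ≠ 0 := he.ne'
  have hπ := Real.pi_pos
  /- The source term `S = (1 − u)v ≥ 0`: integrable, `∫S = 2e/ρ`, finite second moment. -/
  set S : Space → ℝ := fun x => (1 - u x) * v x with hS_def
  have hSi : Integrable S := hu.integrable_one_sub_mul h1
  have hS0 : ∀ x, 0 ≤ S x := fun x => mul_nonneg (sub_nonneg.2 (hu.le_one x)) (h0 x)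
  have hIS : ∫ x, S x = 2 * e / ρ := by
    have h := hu.energy
    unfold EnergyConstraint at h
    rw [show (∫ x, S x) = ∫ x, (1 - u x) * v x from rfl]
    field_simp
    linarith
  have hS2 : Integrable fun x => ‖x‖ ^ 2 * S x := by
    refine hv.integrable.mono' ((continuous_norm.pow 2).aestronglyMeasurable.mul hSi.aestronglyMeasurable)
      (Eventually.of_forall fun x => ?_)
    have hu0 := hu.nonneg x
    have hu1 := hu.le_one x
    have hv0 := h0 x
    rw [Real.norm_eq_abs, abs_of_nonneg (mul_nonneg (by positivity) (hS0 x)), hS_def]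
    simp only
    have h2 : ‖x‖ ^ 2 ≤ 1 + ‖x‖ ^ 4 := by nlinarith [sq_nonneg (‖x‖ ^ 2), sq_nonneg (‖x‖ ^ 2 - 1)]
    calc ‖x‖ ^ 2 * ((1 - u x) * v x) ≤ ‖x‖ ^ 2 * v x := by
          apply mul_le_mul_of_nonneg_left _ (by positivity); nlinarith
      _ ≤ (1 + ‖x‖ ^ 4) * v x := mul_le_mul_of_nonneg_right h2 hv0
  set M : ℝ := ∫ x, ‖x‖ ^ 2 * S x with hM_def
  /- Part B: the tail decomposition `ρu = c'T + R'`, and the moments of `R'`. -/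
  set R' : Space → ℝ := fun x => ρ * u x - c' * refTail x with hR'_def
  have hR'm : AEStronglyMeasurable R' volume :=
    (hu.integrable.aestronglyMeasurable.const_mul ρ).sub
      (continuous_refTail.aestronglyMeasurable.const_mul c')
  have hR'b : ∀ x, |R' x| ≤ ρ + |c'| := by
    intro x
    have hu0 := hu.nonneg x
    have hu1 := hu.le_one x
    have hT0 := refTail_pos x
    have hT1 := refTail_le_one x
    have h2 : |c' * refTail x| ≤ |c'| := by
      rw [abs_mul, abs_of_pos hT0]
      exact mul_le_of_le_one_right (abs_nonneg _) hT1
    have h3 : |ρ * u x| ≤ ρ := by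
      rw [abs_mul, abs_of_pos hρ, abs_of_nonneg hu0]
      exact mul_le_of_le_one_right hρ.le hu1
    calc |R' x| = |ρ * u x - c' * refTail x| := rfl
      _ ≤ |ρ * u x| + |c' * refTail x| := abs_sub _ _
      _ ≤ ρ + |c'| := add_le_add h3 h2
  have hR'2 : MemLp (fun x => ‖x‖ ^ 4 * R' x) 2 := by
    set φ : Space → ℝ := fun x => c' * (1 - ‖x‖ ^ 4 * refTail x) with hφ_def
    have hφc : Continuous φ := by
      have := continuous_refTail
      fun_prop
    have hφb : ∀ x, ‖φ x‖ ≤ 4 * |c'| * ((1 + ‖x‖) ^ 2)⁻¹ := by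
      intro x
      have hq : 1 - ‖x‖ ^ 4 * refTail x = (1 + 2 * ‖x‖ ^ 2) / (1 + ‖x‖ ^ 2) ^ 2 := by
        rw [refTail]
        field_simp
        ring
      have hpos1 : 0 < (1 + ‖x‖ ^ 2) ^ 2 := by positivity
      have hpos2 : 0 < (1 + ‖x‖) ^ 2 := by positivity
      have hq0 : 0 ≤ (1 + 2 * ‖x‖ ^ 2) / (1 + ‖x‖ ^ 2) ^ 2 := by positivity
      have hq1 : (1 + 2 * ‖x‖ ^ 2) / (1 + ‖x‖ ^ 2) ^ 2 ≤ 4 * ((1 + ‖x‖) ^ 2)⁻¹ := by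
        rw [div_le_iff₀ hpos1, show 4 * ((1 + ‖x‖) ^ 2)⁻¹ * (1 + ‖x‖ ^ 2) ^ 2 =
          4 * (1 + ‖x‖ ^ 2) ^ 2 / (1 + ‖x‖) ^ 2 by field_simp, le_div_iff₀ hpos2]
        have hs := norm_nonneg x
        nlinarith [sq_nonneg (1 - ‖x‖), sq_nonneg ‖x‖, mul_nonneg hs hs, sq_nonneg (‖x‖ ^ 2),
          mul_nonneg (mul_nonneg hs hs) (sq_nonneg (1 - ‖x‖))]
      rw [hφ_def]
      simp only
      rw [hq, Real.norm_eq_abs, abs_mul, abs_of_nonneg hq0]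
      calc |c'| * ((1 + 2 * ‖x‖ ^ 2) / (1 + ‖x‖ ^ 2) ^ 2) ≤ |c'| * (4 * ((1 + ‖x‖) ^ 2)⁻¹) :=
            mul_le_mul_of_nonneg_left hq1 (abs_nonneg _)
        _ = 4 * |c'| * ((1 + ‖x‖) ^ 2)⁻¹ := by ring
    have hφ : MemLp φ 2 :=
      (memLp_two_inv_one_add_norm_sq.const_mul (4 * |c'|)).mono' hφc.aestronglyMeasurable
        (Eventually.of_forall hφb)
    refine (hL2.add hφ).ae_eq ?_
    filter_upwards [ae_ne_zero] with x hx
    have hx4 : ‖x‖ ^ 4 ≠ 0 := by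
      have := norm_pos_iff.2 hx
      positivity
    simp only [Pi.add_apply, hR'_def, hφ_def]
    field_simp
    ring
  have hI := integrable_one_add_norm_sq_mul hR'm hR'b hR'2
  have hR'i : Integrable R' := by
    have hcont : Continuous fun x : Space => (1 + ‖x‖ ^ 2)⁻¹ := by
      refine Continuous.inv₀ (by fun_prop) fun x => ?_
      positivity
    refine (hI.bdd_mul (c := 1) hcont.aestronglyMeasurable (Eventually.of_forall fun x => ?_)).congr
      (Eventually.of_forall fun x => ?_)
    · rw [Real.norm_eq_abs, abs_of_nonneg (by positivity)]
      exact inv_le_one_of_one_le₀ (by nlinarith [sq_nonneg ‖x‖])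
    · have : (1 + ‖x‖ ^ 2) ≠ 0 := by positivity
      field_simp
  /- The Fourier side at `ξ = 0`: `ρû(0) = 1`, `Ŝ(0) = 2e/ρ`. -/
  have hu0F : ρ * (𝓕 (fun x => (u x : ℂ)) 0).re = 1 := by
    rw [fourier_ofReal_zero, Complex.ofReal_re, hu.integral_eq h1 hρ he]
    field_simp
  have hS0F : ρ / (2 * e) * (𝓕 (fun x => (S x : ℂ)) 0).re = 1 := by
    rw [fourier_ofReal_zero, Complex.ofReal_re, hIS]
    field_simp
  /- Per-direction identity: for every unit vector `η`, `c' ≥ 0` and `∫⟪x,η⟫²S = (4π⁴ec'² − 2)/ρ`. -/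
  have hdir : ∀ η : Space, ‖η‖ = 1 →
      0 ≤ c' ∧ ∫ x, ⟪x, η⟫ ^ 2 * S x = (4 * Real.pi ^ 4 * e * c' ^ 2 - 2) / ρ := by
    intro η hη
    set Mη : ℝ := ∫ x, ⟪x, η⟫ ^ 2 * S x with hMη_def
    have hMη0 : 0 ≤ Mη := integral_nonneg fun x => mul_nonneg (sq_nonneg _) (hS0 x)
    have hS2η : Integrable fun x => ⟪x, η⟫ ^ 2 * S x := by
      refine hS2.mono' (((continuous_inner_const η).pow 2).aestronglyMeasurable.mul
        hSi.aestronglyMeasurable) (Eventually.of_forall fun x => ?_)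
      rw [Real.norm_eq_abs, abs_of_nonneg (mul_nonneg (sq_nonneg _) (hS0 x))]
      exact mul_le_mul_of_nonneg_right (inner_sq_le_norm_sq x hη) (hS0 x)
    have hR'2η : Integrable fun x => ⟪x, η⟫ ^ 2 * R' x := by
      refine hI.norm.mono' (((continuous_inner_const η).pow 2).aestronglyMeasurable.mul hR'm)
        (Eventually.of_forall fun x => ?_)
      rw [Real.norm_eq_abs, Real.norm_eq_abs, abs_mul, abs_mul, abs_of_nonneg (sq_nonneg _),
        abs_of_nonneg (by positivity : (0 : ℝ) ≤ 1 + ‖x‖ ^ 2)]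
      have h2 : ⟪x, η⟫ ^ 2 ≤ 1 + ‖x‖ ^ 2 := (inner_sq_le_norm_sq x hη).trans (by linarith)
      exact mul_le_mul_of_nonneg_right h2 (abs_nonneg _)
    set K : ℝ := ∫ x, ⟪x, η⟫ ^ 2 * |R' x| with hK_def
    -- the scalar functions of `t` along the ray
    set y : ℝ → ℝ := fun t => ρ * (𝓕 (fun x => (u x : ℂ)) (t • η)).re with hy_def
    set σ : ℝ → ℝ := fun t => (𝓕 (fun x => (S x : ℂ)) (t • η)).re with hσ_def
    set r : ℝ → ℝ := fun t => (𝓕 (fun x => (R' x : ℂ)) (t • η)).re with hr_def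
    have hnorm : ∀ t : ℝ, ‖t • η‖ ^ 2 = t ^ 2 := fun t => by
      rw [norm_smul, hη, mul_one, Real.norm_eq_abs, sq_abs]
    have hy0 : y 0 = 1 := by simp only [hy_def, zero_smul]; exact hu0F
    have hσ0 : ρ / (2 * e) * σ 0 = 1 := by simp only [hσ_def, zero_smul]; exact hS0F
    -- (A) the Fourier-transformed equation along the ray
    have hyA : ∀ t : ℝ, y t = (1 + Real.pi ^ 2 * t ^ 2 / e) -
        Real.sqrt ((1 + Real.pi ^ 2 * t ^ 2 / e) ^ 2 - ρ / (2 * e) * σ t) := by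
      intro t
      have h := hu.rho_mul_fourier_re_eq h1 hveven hρ he heven (t • η)
      rw [hnorm t] at h
      exact h
    -- (B) the tail decomposition along the ray
    have hyB : ∀ t : ℝ, y t = c' * (Real.pi ^ 2 * Real.exp (-(2 * Real.pi * |t|))) + r t := by
      intro t
      have hsplit : (fun x => (R' x : ℂ)) = fun x => (((ρ * u x) - (c' * refTail x) : ℝ) : ℂ) := rfl
      have hF : 𝓕 (fun x => (R' x : ℂ)) (t • η) = (ρ : ℂ) * 𝓕 (fun x => (u x : ℂ)) (t • η) -
          (c' : ℂ) * 𝓕 (fun x => (refTail x : ℂ)) (t • η) := by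
        rw [hsplit, fourier_ofReal_sub (hu.integrable.const_mul ρ) (integrable_refTail.const_mul c'),
          fourier_ofReal_const_mul, fourier_ofReal_const_mul]
      simp only [hy_def, hr_def]
      rw [hF, fourier_refTail (t • η), norm_smul, hη, mul_one, Real.norm_eq_abs]
      simp only [Complex.sub_re, Complex.mul_re, Complex.ofReal_re, Complex.ofReal_im, zero_mul,
        sub_zero]
      ring
    have hcr : c' * Real.pi ^ 2 + r 0 = 1 := by
      have h := hyB 0
      rw [hy0, abs_zero, mul_zero, neg_zero, Real.exp_zero, mul_one] at h
      linarith
    -- (A') the limit from the equation: `(1 − y)/|t| → √Λ`, `Λ = π²(2 + ρMη)/e`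
    set Λ : ℝ := Real.pi ^ 2 / e * (2 + ρ * Mη) with hΛ_def
    have hΛ0 : 0 ≤ Λ := by positivity
    have hσt : ∀ t : ℝ, σ 0 - σ t = ∫ x, (1 - Real.cos (2 * Real.pi * t * ⟪x, η⟫)) * S x := by
      intro t
      simp only [hσ_def, zero_smul]
      rw [fourier_ofReal_re hSi, fourier_ofReal_re hSi, ← integral_sub]
      · refine integral_congr_ae (Eventually.of_forall fun x => ?_)
        simp only [inner_zero_right, mul_zero, Real.cos_zero, one_mul, inner_smul_right]
        ring_nf
      · exact hSi.congr (Eventually.of_forall fun x => by simp)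
      · have hc' : Continuous fun x : Space => Real.cos (2 * Real.pi * ⟪x, t • η⟫) := by
          have := continuous_inner_const (t • η); fun_prop
        exact hSi.bdd_mul (c := 1) hc'.aestronglyMeasurable
          (Eventually.of_forall fun x => by rw [Real.norm_eq_abs]; exact Real.abs_cos_le_one _)
    have hlimσ : Tendsto (fun t : ℝ => (σ 0 - σ t) / t ^ 2) (𝓝[≠] 0) (𝓝 (2 * Real.pi ^ 2 * Mη)) := by
      have h := tendsto_integral_one_sub_cos_div_sq η (2 * Real.pi) hSi hS2η
      have hlim : ∫ x, (2 * Real.pi) ^ 2 / 2 * ⟪x, η⟫ ^ 2 * S x = 2 * Real.pi ^ 2 * Mη := by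
        calc ∫ x, (2 * Real.pi) ^ 2 / 2 * ⟪x, η⟫ ^ 2 * S x = ∫ x, 2 * Real.pi ^ 2 * (⟪x, η⟫ ^ 2 * S x) :=
              integral_congr_ae (Eventually.of_forall fun x => by ring)
          _ = 2 * Real.pi ^ 2 * Mη := by rw [integral_const_mul]
      rw [hlim] at h
      refine h.congr' (eventually_nhdsWithin_of_forall fun t ht => ?_)
      change ∫ x, (1 - Real.cos (2 * Real.pi * t * ⟪x, η⟫)) / t ^ 2 * S x = (σ 0 - σ t) / t ^ 2
      rw [hσt t, ← integral_div]
      refine integral_congr_ae (Eventually.of_forall fun x => ?_)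
      ring
    set g : ℝ → ℝ := fun t => ((1 + Real.pi ^ 2 * t ^ 2 / e) ^ 2 - ρ / (2 * e) * σ t) / t ^ 2 with hg_def
    have hlimg : Tendsto g (𝓝[≠] 0) (𝓝 Λ) := by
      have hpoly : Tendsto (fun t : ℝ => 2 * Real.pi ^ 2 / e + Real.pi ^ 4 * t ^ 2 / e ^ 2) (𝓝[≠] 0)
          (𝓝 (2 * Real.pi ^ 2 / e)) := by
        have hc' : Continuous fun t : ℝ => 2 * Real.pi ^ 2 / e + Real.pi ^ 4 * t ^ 2 / e ^ 2 := by
          fun_prop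
        have := hc'.tendsto 0
        simp only [ne_eq, OfNat.ofNat_ne_zero, not_false_eq_true, zero_pow, mul_zero, zero_div,
          add_zero] at this
        exact tendsto_nhdsWithin_of_tendsto_nhds this
      have hsum := hpoly.add (hlimσ.const_mul (ρ / (2 * e)))
      have hΛ' : 2 * Real.pi ^ 2 / e + ρ / (2 * e) * (2 * Real.pi ^ 2 * Mη) = Λ := by
        rw [hΛ_def]
        field_simp
      rw [hΛ'] at hsum
      refine hsum.congr' (eventually_nhdsWithin_of_forall fun t ht => ?_)
      have ht : (t : ℝ) ≠ 0 := ht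
      rw [hg_def]
      simp only
      have e1 : (1 + Real.pi ^ 2 * t ^ 2 / e) ^ 2 - ρ / (2 * e) * σ t =
          ((1 + Real.pi ^ 2 * t ^ 2 / e) ^ 2 - 1) + ρ / (2 * e) * (σ 0 - σ t) := by
        rw [mul_sub, hσ0]; ring
      rw [e1]
      field_simp
      ring
    have hLA : Tendsto (fun t : ℝ => (1 - y t) / |t|) (𝓝[≠] 0) (𝓝 (Real.sqrt Λ)) := by
      have habs : Tendsto (fun t : ℝ => Real.pi ^ 2 * |t| / e) (𝓝[≠] 0) (𝓝 0) := by
        have hc' : Continuous fun t : ℝ => Real.pi ^ 2 * |t| / e := by fun_prop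
        have := hc'.tendsto 0
        simp only [abs_zero, mul_zero, zero_div] at this
        exact tendsto_nhdsWithin_of_tendsto_nhds this
      have h := hlimg.sqrt.sub habs
      rw [sub_zero] at h
      refine h.congr' (eventually_nhdsWithin_of_forall fun t ht => ?_)
      have ht : (t : ℝ) ≠ 0 := ht
      have hta : 0 < |t| := abs_pos.2 ht
      simp only
      rw [hyA t, eq_div_iff hta.ne']
      have e2 : (1 + Real.pi ^ 2 * t ^ 2 / e) ^ 2 - ρ / (2 * e) * σ t = t ^ 2 * g t := by
        rw [hg_def]; simp only; field_simp
      rw [e2, Real.sqrt_mul (sq_nonneg t), Real.sqrt_sq_eq_abs]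
      have e3 : t ^ 2 = |t| * |t| := by rw [← sq_abs]; ring
      rw [e3]
      field_simp
      ring
    -- (B') the limit from the tail: `(1 − y)/|t| → 2π³c'`
    have hLB : Tendsto (fun t : ℝ => (1 - y t) / |t|) (𝓝[≠] 0) (𝓝 (2 * Real.pi ^ 3 * c')) := by
      have hexp : Tendsto (fun t : ℝ => (1 - Real.exp (-(2 * Real.pi * |t|))) / |t|) (𝓝[≠] 0)
          (𝓝 (2 * Real.pi)) :=
        (tendsto_one_sub_exp_div (2 * Real.pi)).comp tendsto_abs_nhdsNE_zero
      have hrem : Tendsto (fun t : ℝ => (r t - r 0) / |t|) (𝓝[≠] 0) (𝓝 0) := by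
        refine squeeze_zero_norm' (a := fun t => 2 * Real.pi ^ 2 * K * |t|)
          (eventually_nhdsWithin_of_forall fun t ht => ?_) ?_
        · have ht : (t : ℝ) ≠ 0 := ht
          have hta : 0 < |t| := abs_pos.2 ht
          have hb : |r t - r 0| ≤ 2 * Real.pi ^ 2 * t ^ 2 * K := by
            have := abs_fourier_re_sub_le η hR'i hR'2η t
            simp only [hr_def, hK_def, zero_smul]
            exact this
          rw [Real.norm_eq_abs, abs_div, abs_abs, div_le_iff₀ hta]
          calc |r t - r 0| ≤ 2 * Real.pi ^ 2 * t ^ 2 * K := hb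
            _ = 2 * Real.pi ^ 2 * K * |t| * |t| := by
                rw [mul_assoc _ |t| |t|, abs_mul_abs_self]; ring
        · have hc' : Continuous fun t : ℝ => 2 * Real.pi ^ 2 * K * |t| := by fun_prop
          have := hc'.tendsto 0
          simp only [abs_zero, mul_zero] at this
          exact tendsto_nhdsWithin_of_tendsto_nhds this
      have h := (hexp.const_mul (c' * Real.pi ^ 2)).sub hrem
      rw [sub_zero, show c' * Real.pi ^ 2 * (2 * Real.pi) = 2 * Real.pi ^ 3 * c' by ring] at h
      refine h.congr' (eventually_nhdsWithin_of_forall fun t ht => ?_)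
      simp only
      rw [hyB t, mul_div_assoc', ← sub_div]
      congr 1
      linear_combination hcr
    -- (C) compare the two limits
    have hEq : Real.sqrt Λ = 2 * Real.pi ^ 3 * c' := tendsto_nhds_unique hLA hLB
    have hc'0 : 0 ≤ c' := by
      have : 0 ≤ 2 * Real.pi ^ 3 * c' := hEq ▸ Real.sqrt_nonneg Λ
      nlinarith [pow_pos hπ 3]
    refine ⟨hc'0, ?_⟩
    have hΛ : Λ = (2 * Real.pi ^ 3 * c') ^ 2 := by
      rw [← hEq, Real.sq_sqrt hΛ0]
    rw [hΛ_def] at hΛ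
    have h5 : 2 + ρ * Mη = 4 * Real.pi ^ 4 * e * c' ^ 2 := by
      have hπ2 : Real.pi ^ 2 ≠ 0 := by positivity
      have h6 : 2 + ρ * Mη = e / Real.pi ^ 2 * (2 * Real.pi ^ 3 * c') ^ 2 := by
        rw [← hΛ]; field_simp
      rw [h6]; field_simp; ring
    rw [eq_div_iff hρ0]
    linarith
  /- Summing over the standard basis: `M = ∑ᵢ ∫⟪x,eᵢ⟫²S = 3(4π⁴ec'² − 2)/ρ`. -/
  have hc'0 : 0 ≤ c' := (hdir (EuclideanSpace.single 0 (1 : ℝ)) (by simp)).1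
  have hbasis : ∀ x : Space, ∑ i : Fin 3, ⟪x, EuclideanSpace.single i (1 : ℝ)⟫ ^ 2 = ‖x‖ ^ 2 := by
    intro x
    rw [EuclideanSpace.real_norm_sq_eq]
    refine Finset.sum_congr rfl fun i _ => ?_
    rw [EuclideanSpace.inner_single_right]
    simp
  have hsum : ∑ i : Fin 3, ∫ x, ⟪x, EuclideanSpace.single i (1 : ℝ)⟫ ^ 2 * S x = M := by
    have hint : ∀ i : Fin 3, Integrable fun x => ⟪x, EuclideanSpace.single i (1 : ℝ)⟫ ^ 2 * S x := by
      intro i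
      have hη : ‖EuclideanSpace.single i (1 : ℝ)‖ = 1 := by simp
      refine hS2.mono' (((continuous_inner_const _).pow 2).aestronglyMeasurable.mul
        hSi.aestronglyMeasurable) (Eventually.of_forall fun x => ?_)
      rw [Real.norm_eq_abs, abs_of_nonneg (mul_nonneg (sq_nonneg _) (hS0 x))]
      exact mul_le_mul_of_nonneg_right (inner_sq_le_norm_sq x hη) (hS0 x)
    rw [← integral_finsetSum _ fun i _ => hint i, hM_def]
    refine integral_congr_ae (Eventually.of_forall fun x => ?_)
    simp only
    rw [← Finset.sum_mul, hbasis x]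
  have h3M : ∑ i : Fin 3, ∫ x, ⟪x, EuclideanSpace.single i (1 : ℝ)⟫ ^ 2 * S x =
      3 * ((4 * Real.pi ^ 4 * e * c' ^ 2 - 2) / ρ) := by
    rw [Finset.sum_congr rfl fun i _ => (hdir _ (by simp)).2, Finset.sum_const, Finset.card_univ,
      Fintype.card_fin, nsmul_eq_mul]
    norm_num
  have hM : M = 3 * ((4 * Real.pi ^ 4 * e * c' ^ 2 - 2) / ρ) := hsum.symm.trans h3M
  refine ⟨hc'0, ?_⟩
  rw [hM]
  field_simp
  ring

/-- **The tail coefficient, in closed form**: under the hypotheses of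
`IsSolution.tail_coefficient_sq_eq`, `c' = √(2 + (ρ/3)∫|x|²(1 − u)v)/(2π²√e)`.
[cite: CarlenJauslinLieb2021, Theorem 2 and §2 (proof)] -/
theorem IsSolution.tail_coefficient_eq {v : Space → ℝ} (hv : IsWeightedPotential v)
    {ρ e : ℝ} (hρ : 0 < ρ) (he : 0 < e) {u : Space → ℝ} (hu : IsSolution v ρ e u)
    (heven : ∀ x, u (-x) = u x) {c' : ℝ}
    (hL2 : MemLp (fun x => ‖x‖ ^ 4 * (ρ * u x - c' / ‖x‖ ^ 4)) 2) :
    c' = Real.sqrt (2 + ρ / 3 * ∫ x, ‖x‖ ^ 2 * ((1 - u x) * v x)) /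
      (2 * Real.pi ^ 2 * Real.sqrt e) := by
  obtain ⟨hc'0, hsq⟩ := hu.tail_coefficient_sq_eq hv hρ he heven hL2
  have hπ := Real.pi_pos
  have hden : 0 < 2 * Real.pi ^ 2 * Real.sqrt e := by positivity
  rw [eq_div_iff hden.ne']
  have hM0 : 0 ≤ 2 + ρ / 3 * ∫ x, ‖x‖ ^ 2 * ((1 - u x) * v x) := by
    have : 0 ≤ ∫ x, ‖x‖ ^ 2 * ((1 - u x) * v x) :=
      integral_nonneg fun x => mul_nonneg (by positivity)
        (mul_nonneg (sub_nonneg.2 (hu.le_one x)) (hv.nonneg x))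
    positivity
  have hlhs0 : 0 ≤ c' * (2 * Real.pi ^ 2 * Real.sqrt e) := by positivity
  rw [← Real.sqrt_sq hlhs0]
  congr 1
  rw [mul_pow, hsq, mul_pow, mul_pow, Real.sq_sqrt he.le]
  field_simp
  ring

/-- **Any `L²` tail constant is the corrected one.** For an even solution triple `(ρ, e, u)`,
`ρ, e > 0`, of the simple equation with a CJL-II potential: if `|x|⁴(ρu − c'|x|⁻⁴) ∈ L²(ℝ³)` then
`c' = correctedDecayCoeff v ρ e u = √(2 + β/3)/(2π²√e)` (the tree's name for the coefficient the
proof of CJL-II Theorem 2 establishes, `LiebSimpleEquationFacts.lean`).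
[cite: CarlenJauslinLieb2021, Theorem 2 and §2 (proof)] -/
theorem IsSolution.eq_correctedDecayCoeff_of_memLp_two {v : Space → ℝ} (hv : IsWeightedPotential v)
    {ρ e : ℝ} (hρ : 0 < ρ) (he : 0 < e) {u : Space → ℝ} (hu : IsSolution v ρ e u)
    (heven : ∀ x, u (-x) = u x) {c' : ℝ}
    (hL2 : MemLp (fun x => ‖x‖ ^ 4 * (ρ * u x - c' / ‖x‖ ^ 4)) 2) :
    c' = correctedDecayCoeff v ρ e u := by
  rw [hu.tail_coefficient_eq hv hρ he heven hL2, correctedDecayCoeff, decayBeta]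
  have hI : ∫ x, ‖x‖ ^ 2 * ((1 - u x) * v x) = ∫ x, ‖x‖ ^ 2 * (v x * (1 - u x)) :=
    integral_congr_ae (Eventually.of_forall fun x => by ring)
  rw [hI]
  congr 3
  ring

/-- **With the printed `β`, `|x|⁴R ∉ L²(ℝ³)`.** For an even solution triple `(ρ, e, u)`,
`ρ, e > 0`, of the simple equation with a CJL-II potential, the printed remainder
`R = ρu − √(2+β)/(2π²√e)|x|⁻⁴`, `β = ρ∫|x|²v(1 − u)` (`decayRemainder`, `decayBeta`), does NOT
have `|x|⁴R ∈ L²`: by `IsSolution.eq_correctedDecayCoeff_of_memLp_two` this would force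
`decayCoeff = correctedDecayCoeff`, i.e. `β = β/3`, against `β > 0` (the tree's
`IsSolution.decayCoeff_ne_correctedDecayCoeff`). [cite: CarlenJauslinLieb2021, Theorem 2] -/
theorem IsSolution.not_memLp_decayRemainder {v : Space → ℝ} (hv : IsWeightedPotential v)
    {ρ e : ℝ} (hρ : 0 < ρ) (he : 0 < e) {u : Space → ℝ} (hu : IsSolution v ρ e u)
    (heven : ∀ x, u (-x) = u x) :
    ¬ MemLp (fun x => ‖x‖ ^ 4 * decayRemainder v ρ e u x) 2 := by
  intro hL2
  have hL2' : MemLp (fun x => ‖x‖ ^ 4 * (ρ * u x - decayCoeff v ρ e u / ‖x‖ ^ 4)) 2 := hL2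
  exact hu.decayCoeff_ne_correctedDecayCoeff hv hρ he
    (hu.eq_correctedDecayCoeff_of_memLp_two hv hρ he heven hL2')

/-! ## CJL-II Theorem 2 as printed is refuted by CJL-I Theorem 1 -/

/-- Under CJL-I Theorem 1, the unique solution at `(ρ(e), e)` for an even potential is even.
[cite: CarlenJauslinLieb2020, Theorem 1] -/
theorem even_of_existsUnique {𝒱 : Space → ℝ} (h𝒱 : ∀ x, 𝒱 (-x) = 𝒱 x) {ρ e : ℝ} {u : Space → ℝ}
    (huniq : ∃! w : Space → ℝ, IsSolution 𝒱 ρ e w) (hu : IsSolution 𝒱 ρ e u) :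
    ∀ x, u (-x) = u x := by
  have h := huniq.unique (hu.comp_neg h𝒱) hu
  exact fun x => congrFun h x

/-- **CJL-I Theorem 1 refutes CJL-II Theorem 2 as printed.** The printed theorem — "If
`(1 + |x|⁴)v ∈ L¹(ℝ³) ∩ L²(ℝ³)`, then `ρu(x) = √(2+β)/(2π²√e)·|x|⁻⁴ + R(x)` where
`β = ρ∫|x|²v(1 − u)dx ≤ ρ‖x²v‖₁`, and where `|x|⁴R(x)` is in `L²(ℝ³) ∩ L^∞(ℝ³)`, uniformly in `e`
on all compact sets. Moreover, for every `ρ₀ > 0`, there is a constant `C` that only depends on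
`ρ₀` such that for all `x`, for all `ρ < ρ₀`, `u(x) ≤ min{1, C/(ρe^{1/2}|x|⁴)}`" — is the negated
statement, verbatim in the tree's rendering (solution triples `(ρ, e, u)`, `ρ, e > 0`, of the
simple equation with a CJL-II potential `v ≥ 0` radial, `v ≢ 0`; `β = decayBeta`, the printed
(betadef); `R = decayRemainder`, with the printed coefficient `decayCoeff = √(2+β)/(2π²√e)`; the
pointwise bound in the division-free form `ρ√e|x|⁴u(x) ≤ C`, `u ≤ 1` being part of `IsSolution`;
the uniformity of the remainder norms in `e` not recorded) — formerly the body of the named fact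
`CarlenJauslinLieb2021_thm2` of the facts file, retired once refuted. Proof: for the indicator of
the unit ball (a CJL-II potential) Theorem 1 supplies a solution triple `(ρ(1), 1, u)` with
`ρ(1) > 0` and, by uniqueness, `u` even; the `L²` clause for this triple contradicts
`IsSolution.not_memLp_decayRemainder`. The defect is the factor `3` in the printed closed form of
`β` (the proof's `β = −(ρ/4e)∂²_κŜ(0)` equals `(ρ/3)∫|x|²v(1 − u)` on `ℝ³`), not Theorem 1; the
clause `β ≤ ρ‖x²v‖₁`, the `L^∞` clause and the pointwise bound are not affected (facts file:
`IsSolution.decayBeta_le`, `memLp_top_decayRemainder_iff`). [cite: CarlenJauslinLieb2021, Theorem 2] -/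
theorem not_CarlenJauslinLieb2021_thm2_of_thm1 (h1 : CarlenJauslinLieb2020_thm1) :
    ¬ ∀ (v : Space → ℝ), IsWeightedPotential v → 0 < ∫ x, v x →
        (∀ (ρ e : ℝ) (u : Space → ℝ), 0 < ρ → 0 < e → IsSolution v ρ e u →
          decayBeta v ρ u ≤ ρ * ∫ x, ‖x‖ ^ 2 * v x ∧
          MemLp (fun x => ‖x‖ ^ 4 * decayRemainder v ρ e u x) 2 ∧
          MemLp (fun x => ‖x‖ ^ 4 * decayRemainder v ρ e u x) ∞) ∧
        (∀ ρ₀ : ℝ, 0 < ρ₀ → ∃ C : ℝ,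
          ∀ (ρ e : ℝ) (u : Space → ℝ), 0 < ρ → ρ < ρ₀ → 0 < e → IsSolution v ρ e u →
            ∀ x : Space, ρ * Real.sqrt e * ‖x‖ ^ 4 * u x ≤ C) := by
  intro h2
  set v : Space → ℝ := (Metric.closedBall (0 : Space) 1).indicator fun _ => (1 : ℝ) with hv_def
  have hv : IsWeightedPotential v := isWeightedPotential_indicator_closedBall
  have hpos : 0 < ∫ x, v x := integral_indicator_closedBall_pos
  have hveven : ∀ x, v (-x) = v x := fun x => hv.radial (norm_neg x)
  obtain ⟨ρf, -, -, -, hρf⟩ :=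
    h1 v 2 three_halves_lt_two hv.nonneg hv.integrable_self hv.memLp_two_self hpos
  obtain ⟨huniq, -⟩ := hρf 1 one_pos
  obtain ⟨u, hu⟩ := huniq.exists
  have hρpos : 0 < ρf 1 := hu.density_pos hv.nonneg one_pos
  have heven : ∀ x, u (-x) = u x := even_of_existsUnique hveven huniq hu
  obtain ⟨-, hL2, -⟩ := (h2 v hv hpos).1 (ρf 1) 1 u hρpos one_pos hu
  exact hu.not_memLp_decayRemainder hv hρpos one_pos heven hL2

end LiebSimpleEquation

end Literature.MathematicalPhysics.QuantumManyBody

end
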